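import Mathlib
import HarnessLib
import Literature.NumberTheory.LFunctions.RobertSargosSteps123
import Literature.NumberTheory.LFunctions.RobertSargosStep4
import Literature.NumberTheory.LFunctions.RobertSargosStep57
import Literature.NumberTheory.LFunctions.NumHelpers

/-!
# Robert–Sargos 2002, Theorem 1 (the fourth-derivative test) for derivative families — PROVED

Topic `Literature/NumberTheory/LFunctions`. Everything in this file is PROVED (no `sorry`, no defs,
no named facts). It assembles the proof of Theorem 1 of O. Robert, P. Sargos, *A fourth derivative
test for exponential sums*, Compositio Math. 130 (2002), 275–292 (= arXiv:2307.03562v1),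

> `S_M = ∑_{m=1}^{M} e(f(m)) ≪_ε M^ε (M λ^{1/13} + λ^{-7/13})` when `λ ≤ f⁗ ≪ λ` on `[1, M]` (1·6),

in the form `Thm1.theorem1_family`: for a derivative family `D` of order `4` on `[0, L]` with
`t¹³ ≤ D 4 ≤ C₀ t¹³` (`t = λ^{1/13} ∈ (0, 1]`),
`‖∑_{0<n≤L} e(D 0 n)‖ ≤ C(ε, C₀) (L+1)^{2ε} (L t + t⁻⁷)`.
The named fact `Sargos2003_lemma4` (Sargos 2003, Lemma 4 with `u = 0`, = this theorem for
`g ∈ C⁴[1, M]`) is discharged from it in the sibling file `RobertSargosFourthDerivativeProofs.lean`.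

## The chain (§4 of the paper) and where each step lives

* Step 0 (`Thm1.theorem1_family` ← `Thm1.short_bound` + `Thm1.norm_sum_le_blocks`): sums longer than
  `t⁻⁸ = λ^{-8/13}` are cut into `O(Lt⁸)` blocks (translation keeps the hypotheses); sums shorter
  than `64 t⁻⁷` are bounded trivially. DEVIATION from the printed Step 0: instead of completing a sum
  of length `λ^{-7/13} ≪ M < λ^{-8/13}` to length `λ^{-8/13}` (Huxley, Lemma 5.2.3), the whole chain is
  run for every `64 t⁻⁷ ≤ L ≤ t⁻⁸` with the `A`-process length `H = ⌊L² t¹⁴⌋` (`≍ λ^{-2/13}` only at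
  the top of the range); the exponent bookkeeping (`Thm1.poly_core`, `Thm1.arg_numeric`) shows that
  every term of (4·21) is still `≪ L^{2+ε}` exactly on this range.
* Step 1 (`RobertSargos.Thm1.step1`, `small_block_bound`, file `RobertSargosSteps123.lean`):
  symmetric Weyl differencing (4·3), dyadic `H₁ < H` (4·4)–(4·6); `H₁ < 2R` by the third
  derivative test.
* Steps 2–3 (`Thm1.step23`, same file): Lemma 1 (`A × A`), the degenerate terms, the shift (4·12).
* Step 4 (`RobertSargos.step4_partialSummation`, file `RobertSargosStep4.lean`) after the Taylor
  expansion (4·16) (`RobertSargos.taylor_identity`, `RobertSargosTaylorBox.lean`): here in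
  `Thm1.signed_main_bound` / `Thm1.main_term_bound`.
* Steps 5–7 (`RobertSargos.step567` = Lemma 4 + Step 6 + Theorem 2, file `RobertSargosStep57.lean`;
  Theorem 2 = `RobertSargosDiophantine.lean`, Lemma 4 = `RobertSargosLemma4.lean`, Step 6 =
  `RobertSargosFirstSpacing.lean`): also inside `Thm1.signed_main_bound`; the resulting numbers are
  estimated in `Thm1.arg_numeric` (`≪ L^{4+5ε}` after multiplication by `(4LH₁/(QRN))²`) and
  `Thm1.large_block_bound` (`S(H₁)² ≪ L^{2+3ε}`, i.e. (4·7)).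

Parameters: `R = ⌈t⁻¹⌉`, `Q = N = ⌈t⁻³⌉` ((4·8), (4·11)), `H₁ ≤ L²t¹⁴ ≤ t⁻²`, `μ = C₀t¹³M`,
`X₁ = 3QH₁`, `X₂ = 13H₁Q²` ((4·20)); all constants are explicit but not optimised.

## References

* O. Robert, P. Sargos, *A fourth derivative test for exponential sums*, Compositio Math. 130 (2002),
  275–292, doi:10.1023/A:1014363224308 = arXiv:2307.03562v1 — Theorem 1 and §4. [RobertSargos2002]
* P. Sargos, *An analog of van der Corput's `A⁴`-process for exponential sums*, Acta Arith. 110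
  (2003), 219–231 — Lemma 4 (the restatement recorded as `Sargos2003_lemma4`). [Sargos2003]
-/

noncomputable section

open Finset

namespace Literature.NumberTheory.LFunctions
namespace RobertSargos

open Literature.NumberTheory.LFunctions.VdC (e norm_e e_add e_sub e_neg e_int DerivFamily sum_Ioc_shift)
open scoped ComplexConjugate

namespace Thm1

/-! ### Numerical helpers -/

/-- `∑_{i<n} 1/√(i+1) ≤ 2√n`. [folklore] -/
theorem sum_inv_sqrt_le (n : ℕ) :
    ∑ i ∈ Finset.range n, 1 / Real.sqrt ((i : ℝ) + 1) ≤ 2 * Real.sqrt n := by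
  induction n with
  | zero => simp
  | succ n ih =>
    rw [Finset.sum_range_succ]
    push_cast
    have hn0 : (0 : ℝ) ≤ n := by positivity
    have hn1 : (0 : ℝ) < (n : ℝ) + 1 := by positivity
    set a := Real.sqrt (n : ℝ) with ha
    set b := Real.sqrt ((n : ℝ) + 1) with hb
    have ha0 : 0 ≤ a := Real.sqrt_nonneg _
    have hb0 : 0 < b := Real.sqrt_pos.mpr hn1
    have ha2 : a ^ 2 = n := Real.sq_sqrt hn0
    have hb2 : b ^ 2 = n + 1 := Real.sq_sqrt hn1.le
    -- `2a + 1/b ≤ 2b` since `2ab + 1 ≤ 2b²` since `ab ≤ n + 1/2`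
    have hab : a * b ≤ (n : ℝ) + 1 / 2 := by
      nlinarith [sq_nonneg (a - b), sq_nonneg (b - a - 1)]
    have key : 2 * a + 1 / b ≤ 2 * b := by
      rw [← sub_nonneg]
      have : 2 * b - (2 * a + 1 / b) = (2 * b ^ 2 - 2 * (a * b) - 1) / b := by
        field_simp; ring
      rw [this]
      apply div_nonneg _ hb0.le
      nlinarith
    linarith

/-- `log₂ n + 1 ≤ (2/ε + 1) X^ε` when `1 ≤ n ≤ X`. [folklore] -/
theorem natLog_succ_le_rpow {n : ℕ} {X ε : ℝ} (hε : 0 < ε) (hn : 1 ≤ n) (hnX : (n : ℝ) ≤ X) :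
    (Nat.log 2 n : ℝ) + 1 ≤ (2 / ε + 1) * X ^ ε := by
  have hn0 : (0 : ℝ) < n := by exact_mod_cast hn
  have hX1 : 1 ≤ X := le_trans (by exact_mod_cast hn) hnX
  -- `log₂ n ≤ 2 log n`
  have h1 : (Nat.log 2 n : ℝ) ≤ 2 * Real.log n := by
    have g1 : (2 : ℝ) ^ (Nat.log 2 n) ≤ n := by exact_mod_cast Nat.pow_log_le_self 2 (by omega)
    have g2 : (Nat.log 2 n : ℝ) * Real.log 2 ≤ Real.log n := by
      rw [← Real.log_pow]
      exact Real.log_le_log (by positivity) g1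
    have g3 : (1 : ℝ) / 2 < Real.log 2 := by
      have := Real.log_two_gt_d9; linarith
    have g4 : 0 ≤ (Nat.log 2 n : ℝ) := by positivity
    nlinarith only [g2, g3, g4]
  have h2 : Real.log n ≤ (n : ℝ) ^ ε / ε := Real.log_le_rpow_div hn0.le hε
  have h3 : (n : ℝ) ^ ε ≤ X ^ ε := Real.rpow_le_rpow hn0.le hnX hε.le
  have h4 : 1 ≤ X ^ ε := Real.one_le_rpow hX1 hε.le
  have h5 : Real.log n ≤ X ^ ε / ε := h2.trans (div_le_div_of_nonneg_right h3 hε.le)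
  calc (Nat.log 2 n : ℝ) + 1 ≤ 2 * (X ^ ε / ε) + X ^ ε := by linarith
    _ = (2 / ε + 1) * X ^ ε := by ring

/-- `1 + log K ≤ (1/ε + 1) X^ε` when `K ≤ X`, `1 ≤ X` (`K` a natural number). [folklore] -/
theorem one_add_log_le_rpow {K : ℕ} {X ε : ℝ} (hε : 0 < ε) (hX : 1 ≤ X) (hKX : (K : ℝ) ≤ X) :
    1 + Real.log K ≤ (1 / ε + 1) * X ^ ε := by
  have hK0 : (0 : ℝ) ≤ K := by positivity
  have h2 : Real.log K ≤ (K : ℝ) ^ ε / ε := Real.log_le_rpow_div hK0 hε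
  have h3 : (K : ℝ) ^ ε ≤ X ^ ε := Real.rpow_le_rpow hK0 hKX hε.le
  have h4 : 1 ≤ X ^ ε := Real.one_le_rpow hX hε.le
  have h5 : Real.log K ≤ X ^ ε / ε := h2.trans (div_le_div_of_nonneg_right h3 hε.le)
  calc 1 + Real.log K ≤ X ^ ε + X ^ ε / ε := by linarith
    _ = (1 / ε + 1) * X ^ ε := by ring

/-- The exponent bookkeeping of Steps 5–7 of [RS] in the variables `t = λ^{1/13}`, `L`, `H = H₁`:
if `Ht² ≤ 1`, `H ≤ L²t¹⁴`, `Lt⁸ ≤ 1` then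
`(t¹⁰H⁵L + H⁴ + t¹²H⁶L)(Lt¹⁰H² + Lt⁶ + H) ≤ 9 L²t¹⁰H²` — the nine monomial comparisons behind
"(4·24), (4·26) into (4·21) gives (4·19)". [cite: RobertSargos2002, Step 7] -/
theorem poly_core {t L H : ℝ} (ht : 0 < t) (hL : 1 ≤ L) (hH : 1 ≤ H)
    (F1 : H * t ^ 2 ≤ 1) (F2 : H ≤ L ^ 2 * t ^ 14) (F3 : L * t ^ 8 ≤ 1) :
    (t ^ 10 * H ^ 5 * L + H ^ 4 + t ^ 12 * H ^ 6 * L) * (L * t ^ 10 * H ^ 2 + L * t ^ 6 + H) ≤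
      9 * (L ^ 2 * t ^ 10 * H ^ 2) := by
  have hH0 : 0 < H := by linarith
  have hL0 : 0 < L := by linarith
  set P : ℝ := L ^ 2 * t ^ 10 * H ^ 2 with hP
  have hu0 : 0 ≤ H * t ^ 2 := by positivity
  -- powers of `H t² ≤ 1`
  have u2 : (H * t ^ 2) ^ 2 ≤ 1 := pow_le_one₀ hu0 F1
  have u3 : (H * t ^ 2) ^ 3 ≤ 1 := pow_le_one₀ hu0 F1
  have u4 : (H * t ^ 2) ^ 4 ≤ 1 := pow_le_one₀ hu0 F1
  have u5 : (H * t ^ 2) ^ 5 ≤ 1 := pow_le_one₀ hu0 F1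
  have u6 : (H * t ^ 2) ^ 6 ≤ 1 := pow_le_one₀ hu0 F1
  -- `H⁴ ≤ L² t⁸ ≤ L`
  have hL2t8 : L ^ 2 * t ^ 8 ≤ L := by
    calc L ^ 2 * t ^ 8 = L * (L * t ^ 8) := by ring
      _ ≤ L * 1 := mul_le_mul_of_nonneg_left F3 hL0.le
      _ = L := mul_one _
  have hH4 : H ^ 4 ≤ L ^ 2 * t ^ 8 := by
    have h1 : H ^ 4 * t ^ 6 ≤ L ^ 2 * t ^ 14 := by
      calc H ^ 4 * t ^ 6 = (H * t ^ 2) ^ 3 * H := by ring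
        _ ≤ 1 * (L ^ 2 * t ^ 14) := mul_le_mul u3 F2 hH0.le zero_le_one
        _ = L ^ 2 * t ^ 14 := one_mul _
    have h2 : H ^ 4 * t ^ 6 ≤ L ^ 2 * t ^ 8 * t ^ 6 := by linarith [h1]
    exact le_of_mul_le_mul_right h2 (by positivity)
  have hH4L : H ^ 4 ≤ L := hH4.trans hL2t8
  -- `H² ≤ L t⁴`
  have hH2 : H ^ 2 ≤ L * t ^ 4 := by
    have h1 : H ^ 2 * t ^ 2 ≤ L ^ 2 * t ^ 14 := by
      calc H ^ 2 * t ^ 2 = (H * t ^ 2) * H := by ring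
        _ ≤ 1 * (L ^ 2 * t ^ 14) := mul_le_mul F1 F2 hH0.le zero_le_one
        _ = L ^ 2 * t ^ 14 := one_mul _
    have h2 : L ^ 2 * t ^ 14 ≤ L * t ^ 4 * t ^ 2 := by
      calc L ^ 2 * t ^ 14 = (L * t ^ 8) * (L * t ^ 4 * t ^ 2) := by ring
        _ ≤ 1 * (L * t ^ 4 * t ^ 2) := mul_le_mul_of_nonneg_right F3 (by positivity)
        _ = L * t ^ 4 * t ^ 2 := one_mul _
    exact le_of_mul_le_mul_right (h1.trans h2) (by positivity)
  -- `H³ ≤ L² t¹⁰`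
  have hH3 : H ^ 3 ≤ L ^ 2 * t ^ 10 := by
    have h1 : H ^ 3 * t ^ 4 ≤ L ^ 2 * t ^ 14 := by
      calc H ^ 3 * t ^ 4 = (H * t ^ 2) ^ 2 * H := by ring
        _ ≤ 1 * (L ^ 2 * t ^ 14) := mul_le_mul u2 F2 hH0.le zero_le_one
        _ = L ^ 2 * t ^ 14 := one_mul _
    have h2 : L ^ 2 * t ^ 14 = L ^ 2 * t ^ 10 * t ^ 4 := by ring
    rw [h2] at h1
    exact le_of_mul_le_mul_right h1 (by positivity)
  -- `t² H⁵ ≤ L`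
  have hH5 : t ^ 2 * H ^ 5 ≤ L := by
    have h1 : t ^ 8 * H ^ 5 ≤ L ^ 2 * t ^ 14 := by
      calc t ^ 8 * H ^ 5 = (H * t ^ 2) ^ 4 * H := by ring
        _ ≤ 1 * (L ^ 2 * t ^ 14) := mul_le_mul u4 F2 hH0.le zero_le_one
        _ = L ^ 2 * t ^ 14 := one_mul _
    have h2 : L ^ 2 * t ^ 14 ≤ L * t ^ 6 := by
      calc L ^ 2 * t ^ 14 = (L ^ 2 * t ^ 8) * t ^ 6 := by ring
        _ ≤ L * t ^ 6 := mul_le_mul_of_nonneg_right hL2t8 (by positivity)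
    have h3 : t ^ 2 * H ^ 5 * t ^ 6 ≤ L * t ^ 6 := by
      calc t ^ 2 * H ^ 5 * t ^ 6 = t ^ 8 * H ^ 5 := by ring
        _ ≤ L * t ^ 6 := h1.trans h2
    exact le_of_mul_le_mul_right h3 (by positivity)
  -- the nine products
  have p1 : t ^ 10 * H ^ 5 * L * (L * t ^ 10 * H ^ 2) ≤ P := by
    calc _ = (H * t ^ 2) ^ 5 * P := by rw [hP]; ring
      _ ≤ 1 * P := mul_le_mul_of_nonneg_right u5 (by positivity)
      _ = P := one_mul _
  have p2 : t ^ 10 * H ^ 5 * L * (L * t ^ 6) ≤ P := by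
    calc _ = (H * t ^ 2) ^ 3 * P := by rw [hP]; ring
      _ ≤ 1 * P := mul_le_mul_of_nonneg_right u3 (by positivity)
      _ = P := one_mul _
  have p3 : t ^ 10 * H ^ 5 * L * H ≤ P := by
    calc _ = H ^ 4 * (t ^ 10 * H ^ 2 * L) := by ring
      _ ≤ L * (t ^ 10 * H ^ 2 * L) := mul_le_mul_of_nonneg_right hH4L (by positivity)
      _ = P := by rw [hP]; ring
  have p4 : H ^ 4 * (L * t ^ 10 * H ^ 2) ≤ P := by
    calc _ = H ^ 4 * (t ^ 10 * H ^ 2 * L) := by ring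
      _ ≤ L * (t ^ 10 * H ^ 2 * L) := mul_le_mul_of_nonneg_right hH4L (by positivity)
      _ = P := by rw [hP]; ring
  have p5 : H ^ 4 * (L * t ^ 6) ≤ P := by
    calc _ = H ^ 2 * (H ^ 2 * L * t ^ 6) := by ring
      _ ≤ (L * t ^ 4) * (H ^ 2 * L * t ^ 6) := mul_le_mul_of_nonneg_right hH2 (by positivity)
      _ = P := by rw [hP]; ring
  have p6 : H ^ 4 * H ≤ P := by
    calc _ = H ^ 3 * H ^ 2 := by ring
      _ ≤ (L ^ 2 * t ^ 10) * H ^ 2 := mul_le_mul_of_nonneg_right hH3 (by positivity)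
      _ = P := by rw [hP]
  have p7 : t ^ 12 * H ^ 6 * L * (L * t ^ 10 * H ^ 2) ≤ P := by
    calc _ = (H * t ^ 2) ^ 6 * P := by rw [hP]; ring
      _ ≤ 1 * P := mul_le_mul_of_nonneg_right u6 (by positivity)
      _ = P := one_mul _
  have p8 : t ^ 12 * H ^ 6 * L * (L * t ^ 6) ≤ P := by
    calc _ = (H * t ^ 2) ^ 4 * P := by rw [hP]; ring
      _ ≤ 1 * P := mul_le_mul_of_nonneg_right u4 (by positivity)
      _ = P := one_mul _
  have p9 : t ^ 12 * H ^ 6 * L * H ≤ P := by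
    calc _ = (t ^ 2 * H ^ 5) * (t ^ 10 * H ^ 2 * L) := by ring
      _ ≤ L * (t ^ 10 * H ^ 2 * L) := mul_le_mul_of_nonneg_right hH5 (by positivity)
      _ = P := by rw [hP]; ring
  have expand : (t ^ 10 * H ^ 5 * L + H ^ 4 + t ^ 12 * H ^ 6 * L) * (L * t ^ 10 * H ^ 2 + L * t ^ 6 + H) =
      t ^ 10 * H ^ 5 * L * (L * t ^ 10 * H ^ 2) + t ^ 10 * H ^ 5 * L * (L * t ^ 6) + t ^ 10 * H ^ 5 * L * H +
      (H ^ 4 * (L * t ^ 10 * H ^ 2) + H ^ 4 * (L * t ^ 6) + H ^ 4 * H) +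
      (t ^ 12 * H ^ 6 * L * (L * t ^ 10 * H ^ 2) + t ^ 12 * H ^ 6 * L * (L * t ^ 6) + t ^ 12 * H ^ 6 * L * H) := by
    ring
  rw [expand]
  linarith only [p1, p2, p3, p4, p5, p6, p7, p8, p9]

/-! ### Steps 4–7 for the main term of (4·12) -/

set_option maxHeartbeats 4000000 in
open Classical in
/-- **Steps 4, 5, 6, 7 of [RS] for the main term of (4·12)**, one sign of `q` at a time
(`q = s(q'+1)`, `h = H₁ + h'`, `n = n' + 1`): the Taylor expansion (4·16)
(`RobertSargos.taylor_identity`; the factor `e(-2rf'(m) - (r³/3)f'''(m))` has modulus one), Step 4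
(`RobertSargos.step4_partialSummation`, removing `e(u_{m,r}(q,h,n))`) and Lemma 4 with the counts of
Steps 6–7 (`RobertSargos.step567`) give
`∑_{0<|r|<R} ∑_{m ∈ J₀} |∑_{q',h',n'} (1-|q|/Q) θ_r(h) e(Δ_h f(m+n+q) - Δ_{h+r} f(m+n))| ≤ 8 D_u √(RHS of Lemma 4)`,
`J₀ = (Y₀, L - Y₀ - N]`, `Y₀ = Q + N + 3H₁ + R + 7`, `D_u = 1 + 7K + 200K² + 250K³`, `K = 4ΛY₀⁴`.
[cite: RobertSargos2002, Steps 4–7, (4.12)–(4.21)] -/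
theorem signed_main_bound {ε : ℝ} (hε : 0 < ε) : ∃ C : ℝ, 0 < C ∧
    ∀ (D : ℕ → ℝ → ℝ) (L : ℕ) (lam Λ : ℝ), DerivFamily D 0 L 4 →
      (∀ t ∈ Set.Icc (0 : ℝ) L, lam ≤ D 4 t ∧ D 4 t ≤ Λ) → 0 < lam → lam ≤ Λ →
    ∀ (s : ℤ), (s = 1 ∨ s = -1) → ∀ (qf : ℕ → ℤ), (∀ q', qf q' = s * ((q' : ℤ) + 1)) →
    ∀ (R Q N H₁ : ℕ), 1 ≤ R → 1 ≤ N → 2 * R ≤ H₁ → N ≤ Q → H₁ ≤ Q →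
    ∀ (Y₀ : ℤ), Y₀ = (Q : ℤ) + N + 3 * H₁ + R + 7 →
    ∀ (M : ℕ), 1 ≤ M → (M : ℤ) = (L : ℤ) - 2 * Y₀ - N →
    ∀ (θ : ℤ → ℤ → ℂ), (∀ r h, ‖θ r h‖ ≤ 1) →
      ∑ r ∈ (Finset.Ioo (-(R : ℤ)) R).erase 0, ∑ m ∈ Finset.Ioc Y₀ ((L : ℤ) - Y₀ - N),
          ‖∑ q' ∈ range (Q - 1), ∑ h' ∈ range H₁, ∑ n' ∈ range N,
              (((1 - |((qf q' : ℤ) : ℝ)| / Q) : ℝ) : ℂ) * θ r ((H₁ : ℤ) + h') *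
                e (D 0 ((m : ℝ) + (((n' : ℤ) + 1 : ℤ) : ℝ) + ((qf q' : ℤ) : ℝ) + ((((H₁ : ℤ) + h' : ℤ)) : ℝ)) -
                    D 0 ((m : ℝ) + (((n' : ℤ) + 1 : ℤ) : ℝ) + ((qf q' : ℤ) : ℝ) - ((((H₁ : ℤ) + h' : ℤ)) : ℝ)) -
                  (D 0 ((m : ℝ) + (((n' : ℤ) + 1 : ℤ) : ℝ) + ((((H₁ : ℤ) + h' : ℤ)) : ℝ) + r) -
                    D 0 ((m : ℝ) + (((n' : ℤ) + 1 : ℤ) : ℝ) - ((((H₁ : ℤ) + h' : ℤ)) : ℝ) - r)))‖ ≤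
        8 * (1 + 7 * (4 * Λ * (Y₀ : ℝ) ^ 4) + 200 * (4 * Λ * (Y₀ : ℝ) ^ 4) ^ 2 + 250 * (4 * Λ * (Y₀ : ℝ) ^ 4) ^ 3) *
        Real.sqrt (624 ^ 2 * ((Nat.log 2 Q : ℝ) + 1) ^ 2 * ((Finset.Ioo (-(R : ℤ)) R).erase 0).card *
          ((1 + 3 * (Q : ℝ) * H₁) * (1 + Λ * M * (13 * (H₁ : ℝ) * (Q : ℝ) ^ 2))) *
          (C * (((R : ℝ) * N * H₁ * Q) ^ (1 + ε) +
            ((R : ℝ) * N * H₁ * Q) ^ ε * (R * N * (1 / (Λ * M) + 4 * R * (H₁ : ℝ) ^ 2)))) *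
          (M + 2 * (2 * (Λ / lam) * M * (2 * (3 * (Q : ℝ) * H₁))⁻¹ * ⌊(2 * (13 * (H₁ : ℝ) * (Q : ℝ) ^ 2))⁻¹ / lam⌋₊ +
            2 * (Λ / lam) * lam * M * (⌊(2 * (13 * (H₁ : ℝ) * (Q : ℝ) ^ 2))⁻¹ / lam⌋₊ : ℝ) ^ 2 +
            (2 * (2 * (3 * (Q : ℝ) * H₁))⁻¹ + 1) * ((2 * (3 * (Q : ℝ) * H₁))⁻¹ / lam) *
              (1 + Real.log ⌊(2 * (13 * (H₁ : ℝ) * (Q : ℝ) ^ 2))⁻¹ / lam⌋₊) +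
            (2 * (2 * (3 * (Q : ℝ) * H₁))⁻¹ + 1) * ⌊(2 * (13 * (H₁ : ℝ) * (Q : ℝ) ^ 2))⁻¹ / lam⌋₊))) := by
  obtain ⟨C, hC0, hC⟩ := step567 hε
  refine ⟨C, hC0, ?_⟩
  intro D L lam Λ hD hb4 hlam hΛ s hs qf hqf R Q N H₁ hR hN h2R hNQ hHQ Y₀ hY₀ M hM1 hM θ hθ
  have hΛ0 : 0 < Λ := lt_of_lt_of_le hlam hΛ
  have hΛabs : ∀ t ∈ Set.Icc (0 : ℝ) L, |D 4 t| ≤ Λ := fun t ht => by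
    rw [abs_le]; constructor <;> linarith [(hb4 t ht).1, (hb4 t ht).2]
  have hQ1 : 1 ≤ Q := by omega
  have hQ0 : (0 : ℝ) < Q := by exact_mod_cast hQ1
  set Rs := (Finset.Ioo (-(R : ℤ)) R).erase 0 with hRs
  set J₀ := Finset.Ioc Y₀ ((L : ℤ) - Y₀ - N) with hJ₀
  have hRs' : ∀ r ∈ Rs, r ≠ 0 ∧ |r| < R := by
    intro r hr; rw [hRs, Finset.mem_erase, Finset.mem_Ioo] at hr; exact ⟨hr.1, abs_lt.mpr hr.2⟩
  have hJ₀' : ∀ m ∈ J₀, Y₀ + 1 ≤ m ∧ m ≤ Y₀ + M := by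
    intro m hm; rw [hJ₀, Finset.mem_Ioc] at hm; omega
  have hY₀0 : (0 : ℝ) ≤ Y₀ := by
    have : (0 : ℤ) ≤ Y₀ := by omega
    exact_mod_cast this
  -- weights
  have hW : ∀ q', q' + 1 < Q → 0 ≤ 1 - |((qf q' : ℤ) : ℝ)| / Q ∧ 1 - |((qf q' : ℤ) : ℝ)| / Q ≤ 1 := by
    intro q' hq'
    have habs : |((qf q' : ℤ) : ℝ)| = (q' : ℝ) + 1 := by
      have h0 : (0 : ℝ) ≤ (q' : ℝ) + 1 := by positivity
      rw [hqf]
      rcases hs with h | h <;> rw [h] <;> push_cast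
      · rw [one_mul, abs_of_nonneg h0]
      · rw [neg_one_mul, abs_neg, abs_of_nonneg h0]
    rw [habs]
    have : (q' : ℝ) + 1 ≤ Q := by exact_mod_cast hq'.le
    constructor
    · rw [sub_nonneg, div_le_one hQ0]; exact this
    · have : 0 ≤ ((q' : ℝ) + 1) / Q := by positivity
      linarith
  -- the Taylor phases and coefficients
  obtain ⟨ph, hph⟩ : ∃ ph : ℤ → ℤ → ℕ → ℕ → ℕ → ℝ, ∀ r m q' h' n', ph r m q' h' n' =
      2 * D 2 m * ((P₁ r (qf q') ((H₁ : ℤ) + h') ((n' : ℤ) + 1) : ℤ) : ℝ) +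
        D 3 m * ((P₂ r (qf q') ((H₁ : ℤ) + h') ((n' : ℤ) + 1) : ℤ) : ℝ) := ⟨_, fun _ _ _ _ _ => rfl⟩
  obtain ⟨cc, hcc⟩ : ∃ cc : ℤ → ℤ → ℕ → ℕ → ℕ → ℂ, ∀ r m q' h' n', cc r m q' h' n' =
      (((1 - |((qf q' : ℤ) : ℝ)| / Q) : ℝ) : ℂ) * θ r ((H₁ : ℤ) + h') * e (ph r m q' h' n') :=
    ⟨_, fun _ _ _ _ _ => rfl⟩
  have hcc1 : ∀ r m q' h' n', q' + 1 < Q → ‖cc r m q' h' n'‖ ≤ 1 := by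
    intro r m q' h' n' hq'
    rw [hcc, norm_mul, norm_mul, norm_e, mul_one, Complex.norm_real, Real.norm_eq_abs,
      abs_of_nonneg (hW q' hq').1]
    calc _ ≤ (1 : ℝ) * 1 := mul_le_mul (hW q' hq').2 (hθ _ _) (norm_nonneg _) zero_le_one
      _ = 1 := one_mul _
  -- (4·16)
  have htaylor : ∀ (r m : ℤ) (q' h' n' : ℕ),
      (((1 - |((qf q' : ℤ) : ℝ)| / Q) : ℝ) : ℂ) * θ r ((H₁ : ℤ) + h') *
        e (D 0 ((m : ℝ) + (((n' : ℤ) + 1 : ℤ) : ℝ) + ((qf q' : ℤ) : ℝ) + ((((H₁ : ℤ) + h' : ℤ)) : ℝ)) -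
            D 0 ((m : ℝ) + (((n' : ℤ) + 1 : ℤ) : ℝ) + ((qf q' : ℤ) : ℝ) - ((((H₁ : ℤ) + h' : ℤ)) : ℝ)) -
          (D 0 ((m : ℝ) + (((n' : ℤ) + 1 : ℤ) : ℝ) + ((((H₁ : ℤ) + h' : ℤ)) : ℝ) + r) -
            D 0 ((m : ℝ) + (((n' : ℤ) + 1 : ℤ) : ℝ) - ((((H₁ : ℤ) + h' : ℤ)) : ℝ) - r))) =
      e (-2 * r * D 1 m - (r : ℝ) ^ 3 / 3 * D 3 m) * (cc r m q' h' n' * e (Ubox D m r s H₁ q' h' n')) := by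
    intro r m q' h' n'
    rw [taylor_identity D (m : ℝ) r (qf q') ((H₁ : ℤ) + h') ((n' : ℤ) + 1), hcc, hph]
    have hU : uPert D (m : ℝ) (r : ℝ) ((qf q' : ℤ) : ℝ) ((((H₁ : ℤ) + h' : ℤ)) : ℝ) ((((n' : ℤ) + 1 : ℤ)) : ℝ) =
        Ubox D m r s H₁ q' h' n' := by
      rw [Ubox, hqf]; push_cast; ring_nf
    rw [← hU]
    have e3 : -2 * (r : ℝ) * D 1 m + 2 * D 2 m * ((P₁ r (qf q') ((H₁ : ℤ) + h') ((n' : ℤ) + 1) : ℤ) : ℝ) +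
          D 3 m * ((P₂ r (qf q') ((H₁ : ℤ) + h') ((n' : ℤ) + 1) : ℤ) : ℝ) - (r : ℝ) ^ 3 / 3 * D 3 m +
          uPert D (m : ℝ) (r : ℝ) ((qf q' : ℤ) : ℝ) ((((H₁ : ℤ) + h' : ℤ)) : ℝ) ((((n' : ℤ) + 1 : ℤ)) : ℝ) =
        (-2 * r * D 1 m - (r : ℝ) ^ 3 / 3 * D 3 m) +
          ((2 * D 2 m * ((P₁ r (qf q') ((H₁ : ℤ) + h') ((n' : ℤ) + 1) : ℤ) : ℝ) +
            D 3 m * ((P₂ r (qf q') ((H₁ : ℤ) + h') ((n' : ℤ) + 1) : ℤ) : ℝ)) +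
          uPert D (m : ℝ) (r : ℝ) ((qf q' : ℤ) : ℝ) ((((H₁ : ℤ) + h' : ℤ)) : ℝ) ((((n' : ℤ) + 1 : ℤ)) : ℝ)) := by
      ring
    rw [e3, e_add, e_add]
    ring
  -- pulling out the unimodular factor
  have hpull : ∀ r m : ℤ,
      ‖∑ q' ∈ range (Q - 1), ∑ h' ∈ range H₁, ∑ n' ∈ range N,
          (((1 - |((qf q' : ℤ) : ℝ)| / Q) : ℝ) : ℂ) * θ r ((H₁ : ℤ) + h') *
            e (D 0 ((m : ℝ) + (((n' : ℤ) + 1 : ℤ) : ℝ) + ((qf q' : ℤ) : ℝ) + ((((H₁ : ℤ) + h' : ℤ)) : ℝ)) -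
                D 0 ((m : ℝ) + (((n' : ℤ) + 1 : ℤ) : ℝ) + ((qf q' : ℤ) : ℝ) - ((((H₁ : ℤ) + h' : ℤ)) : ℝ)) -
              (D 0 ((m : ℝ) + (((n' : ℤ) + 1 : ℤ) : ℝ) + ((((H₁ : ℤ) + h' : ℤ)) : ℝ) + r) -
                D 0 ((m : ℝ) + (((n' : ℤ) + 1 : ℤ) : ℝ) - ((((H₁ : ℤ) + h' : ℤ)) : ℝ) - r)))‖ =
      ‖∑ q' ∈ range (Q - 1), ∑ h' ∈ range H₁, ∑ n' ∈ range N,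
          cc r m q' h' n' * e (Ubox D m r s H₁ q' h' n')‖ := by
    intro r m
    simp_rw [htaylor r m]
    simp only [← Finset.mul_sum]
    rw [norm_mul, norm_e, one_mul]
  rw [Finset.sum_congr rfl fun r _ => Finset.sum_congr rfl fun m _ => hpull r m]
  -- Step 4 for each `r`
  set Du : ℝ := 1 + 7 * (4 * Λ * (Y₀ : ℝ) ^ 4) + 200 * (4 * Λ * (Y₀ : ℝ) ^ 4) ^ 2 +
    250 * (4 * Λ * (Y₀ : ℝ) ^ 4) ^ 3 with hDu
  have hDu0 : 0 ≤ Du := by rw [hDu]; positivity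
  have hJsub : ∀ m ∈ J₀, Set.Icc ((m : ℝ) - Y₀) (m + Y₀) ⊆ Set.Icc (0 : ℝ) L := by
    intro m hm
    obtain ⟨h1, h2⟩ := hJ₀' m hm
    have c1 : ((Y₀ + 1 : ℤ) : ℝ) ≤ m := by exact_mod_cast h1
    have c2 : ((m : ℤ) : ℝ) ≤ ((Y₀ + M : ℤ) : ℝ) := by exact_mod_cast h2
    have c3 : ((M : ℤ) : ℝ) = (((L : ℤ) - 2 * Y₀ - N : ℤ) : ℝ) := by rw [hM]
    push_cast at c1 c2 c3
    have hN0 : (0 : ℝ) ≤ N := by positivity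
    intro x hx
    exact ⟨by linarith [hx.1], by linarith [hx.2]⟩
  have hstep4 : ∀ r : ℤ, ∃ A' B' C' : ℕ, A' ≤ Q - 1 ∧ B' ≤ H₁ ∧ C' ≤ N ∧ (r ∈ Rs →
      ∑ m ∈ J₀, ‖∑ q' ∈ range (Q - 1), ∑ h' ∈ range H₁, ∑ n' ∈ range N,
          cc r m q' h' n' * e (Ubox D m r s H₁ q' h' n')‖ ≤
        8 * Du * ∑ m ∈ J₀, ‖∑ q' ∈ range A', ∑ h' ∈ range B', ∑ n' ∈ range C', cc r m q' h' n'‖) := by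
    intro r
    by_cases hr : r ∈ Rs
    · obtain ⟨hr0, hrR⟩ := hRs' r hr
      have hYbig : ((Q - 1 : ℕ) : ℝ) + H₁ + N + ((H₁ : ℤ) : ℝ) + |(r : ℝ)| + 7 ≤ (Y₀ : ℝ) := by
        have c1 : ((Q - 1 : ℕ) : ℝ) ≤ Q := by exact_mod_cast Nat.sub_le Q 1
        have c2 : |(r : ℝ)| ≤ R := by
          have : ((|r| : ℤ) : ℝ) < R := by exact_mod_cast hrR
          rw [Int.cast_abs] at this; exact this.le
        have c3 : ((Y₀ : ℤ) : ℝ) = (((Q : ℤ) + N + 3 * H₁ + R + 7 : ℤ) : ℝ) := by rw [hY₀]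
        push_cast at c3 ⊢
        linarith
      obtain ⟨A', B', C', hA', hB', hC', hb⟩ := step4_partialSummation hD hΛabs hΛ0.le r s (H₁ : ℤ) hs
        (by positivity) (Q - 1) H₁ N hYbig J₀ hJsub (cc r)
      exact ⟨A', B', C', hA', hB', hC', fun _ => hb⟩
    · exact ⟨0, 0, 0, by omega, by omega, by omega, fun h => absurd h hr⟩
  choose Af Bf Cf hAf hBf hCf hbound using hstep4
  have hsum4 : ∑ r ∈ Rs, ∑ m ∈ J₀, ‖∑ q' ∈ range (Q - 1), ∑ h' ∈ range H₁, ∑ n' ∈ range N,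
        cc r m q' h' n' * e (Ubox D m r s H₁ q' h' n')‖ ≤
      8 * Du * ∑ r ∈ Rs, ∑ m ∈ J₀, ‖∑ q' ∈ range (Af r), ∑ h' ∈ range (Bf r), ∑ n' ∈ range (Cf r), cc r m q' h' n'‖ := by
    rw [Finset.mul_sum]
    exact Finset.sum_le_sum fun r hr => hbound r hr
  refine hsum4.trans (mul_le_mul_of_nonneg_left ?_ (by positivity))
  -- Steps 5–7
  obtain ⟨β, hβ⟩ : ∃ β : ℤ → ℕ × ℕ × ℕ → ℂ, ∀ r y, β r y =
      (if y.1 + 1 < Q then ((((1 - |((qf y.1 : ℤ) : ℝ)| / Q) : ℝ) : ℂ) * θ r ((H₁ : ℤ) + y.2.1)) else 0) :=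
    ⟨_, fun _ _ => rfl⟩
  have hβ1 : ∀ r y, ‖β r y‖ ≤ 1 := by
    intro r y; rw [hβ]; split_ifs with hy
    · rw [norm_mul, Complex.norm_real, Real.norm_eq_abs, abs_of_nonneg (hW y.1 hy).1]
      calc _ ≤ (1 : ℝ) * 1 := mul_le_mul (hW y.1 hy).2 (hθ _ _) (norm_nonneg _) zero_le_one
        _ = 1 := one_mul _
    · simp
  -- the box sums in the form of `step567`
  have hboxsum : ∀ r ∈ Rs, ∀ m : ℤ,
      ∑ q' ∈ range (Af r), ∑ h' ∈ range (Bf r), ∑ n' ∈ range (Cf r), cc r m q' h' n' =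
        ∑ y ∈ range (Af r) ×ˢ range (Bf r) ×ˢ range (Cf r),
          β r y * e ((2 * D 2 m) * (bP₁ s H₁ r y : ℤ) + D 3 m * ((bP₂ s H₁ r y : ℤ) : ℝ)) := by
    intro r hr m
    rw [Finset.sum_product]
    refine Finset.sum_congr rfl fun q' hq' => ?_
    rw [Finset.sum_product]
    refine Finset.sum_congr rfl fun h' _ => Finset.sum_congr rfl fun n' _ => ?_
    rw [Finset.mem_range] at hq'
    have hq'Q : q' + 1 < Q := by have := hAf r; omega
    rw [hcc, hβ, if_pos hq'Q, hph, bP₁, bP₂, boxQ, boxH, boxN, hqf]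
  rw [Finset.sum_congr rfl fun r hr => Finset.sum_congr rfl fun m _ => by rw [hboxsum r hr m]]
  -- apply Lemma 4 with the counts
  have hbox : ∀ r ∈ Rs, Af r + 1 ≤ Q ∧ Bf r ≤ H₁ ∧ Cf r ≤ N := by
    intro r _; have := hAf r; have := hBf r; have := hCf r; omega
  have hca : (0 : ℝ) ≤ (Y₀ : ℝ) + 1 := by linarith
  have hcb : ((Y₀ : ℤ) : ℝ) + M ≤ (L : ℝ) := by
    have c3 : ((M : ℤ) : ℝ) = (((L : ℤ) - 2 * Y₀ - N : ℤ) : ℝ) := by rw [hM]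
    push_cast at c3
    have : (0 : ℝ) ≤ N := by positivity
    have hMr : (M : ℝ) = ((M : ℤ) : ℝ) := by simp
    linarith
  have key := hC D 0 L lam Λ hD hb4 hlam hΛ s hs R Q N H₁ hR hN h2R hNQ hHQ Rs hRs' Af Bf Cf hbox Y₀ M hM1
    hca hcb J₀ hJ₀' β hβ1
  have hX0 : 0 ≤ ∑ r ∈ Rs, ∑ m ∈ J₀, ‖∑ y ∈ range (Af r) ×ˢ range (Bf r) ×ˢ range (Cf r),
      β r y * e ((2 * D 2 m) * (bP₁ s H₁ r y : ℤ) + D 3 m * ((bP₂ s H₁ r y : ℤ) : ℝ))‖ :=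
    Finset.sum_nonneg fun _ _ => Finset.sum_nonneg fun _ _ => norm_nonneg _
  calc _ = Real.sqrt ((∑ r ∈ Rs, ∑ m ∈ J₀, ‖∑ y ∈ range (Af r) ×ˢ range (Bf r) ×ˢ range (Cf r),
      β r y * e ((2 * D 2 m) * (bP₁ s H₁ r y : ℤ) + D 3 m * ((bP₂ s H₁ r y : ℤ) : ℝ))‖) ^ 2) :=
        (Real.sqrt_sq hX0).symm
    _ ≤ _ := Real.sqrt_le_sqrt key

/-- **The main term of (4·12)**, both signs of `q`: `∑_{r≠0} (1/N) ∑_{m∈J₀} |∑_{q≠0,h,n} …| ≤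
(1/N) · 16 D_u √(RHS of Lemma 4)` (`Thm1.sum_qhn_reindex` + `Thm1.signed_main_bound` twice).
[cite: RobertSargos2002, Steps 4–7] -/
theorem main_term_bound {ε : ℝ} (hε : 0 < ε) : ∃ C : ℝ, 0 < C ∧
    ∀ (D : ℕ → ℝ → ℝ) (L : ℕ) (lam Λ : ℝ), DerivFamily D 0 L 4 →
      (∀ t ∈ Set.Icc (0 : ℝ) L, lam ≤ D 4 t ∧ D 4 t ≤ Λ) → 0 < lam → lam ≤ Λ →
    ∀ (R Q N H₁ : ℕ), 1 ≤ R → 1 ≤ N → 2 * R ≤ H₁ → N ≤ Q → H₁ ≤ Q →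
    ∀ (Y₀ : ℤ), Y₀ = (Q : ℤ) + N + 3 * H₁ + R + 7 →
    ∀ (M : ℕ), 1 ≤ M → (M : ℤ) = (L : ℤ) - 2 * Y₀ - N →
    ∀ (θ : ℤ → ℤ → ℂ), (∀ r h, ‖θ r h‖ ≤ 1) →
      ∑ r ∈ (Finset.Ioo (-(R : ℤ)) R).erase 0,
        (1 / (N : ℝ) * ∑ m ∈ Finset.Ioc Y₀ ((L : ℤ) - Y₀ - N),
          ‖∑ q ∈ (Finset.Ioo (-(Q : ℤ)) Q).erase 0, ∑ h ∈ Finset.Ico (H₁ : ℤ) (2 * H₁),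
              ∑ n ∈ Finset.Icc (1 : ℤ) N,
            (((1 - |(q : ℝ)| / Q : ℝ)) : ℂ) * θ r h *
              e (D 0 ((m : ℝ) + n + q + h) - D 0 ((m : ℝ) + n + q - h) -
                (D 0 ((m : ℝ) + n + h + r) - D 0 ((m : ℝ) + n - h - r)))‖) ≤
        1 / (N : ℝ) * (16 *
          (1 + 7 * (4 * Λ * (Y₀ : ℝ) ^ 4) + 200 * (4 * Λ * (Y₀ : ℝ) ^ 4) ^ 2 + 250 * (4 * Λ * (Y₀ : ℝ) ^ 4) ^ 3) *
        Real.sqrt (624 ^ 2 * ((Nat.log 2 Q : ℝ) + 1) ^ 2 * ((Finset.Ioo (-(R : ℤ)) R).erase 0).card *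
          ((1 + 3 * (Q : ℝ) * H₁) * (1 + Λ * M * (13 * (H₁ : ℝ) * (Q : ℝ) ^ 2))) *
          (C * (((R : ℝ) * N * H₁ * Q) ^ (1 + ε) +
            ((R : ℝ) * N * H₁ * Q) ^ ε * (R * N * (1 / (Λ * M) + 4 * R * (H₁ : ℝ) ^ 2)))) *
          (M + 2 * (2 * (Λ / lam) * M * (2 * (3 * (Q : ℝ) * H₁))⁻¹ * ⌊(2 * (13 * (H₁ : ℝ) * (Q : ℝ) ^ 2))⁻¹ / lam⌋₊ +
            2 * (Λ / lam) * lam * M * (⌊(2 * (13 * (H₁ : ℝ) * (Q : ℝ) ^ 2))⁻¹ / lam⌋₊ : ℝ) ^ 2 +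
            (2 * (2 * (3 * (Q : ℝ) * H₁))⁻¹ + 1) * ((2 * (3 * (Q : ℝ) * H₁))⁻¹ / lam) *
              (1 + Real.log ⌊(2 * (13 * (H₁ : ℝ) * (Q : ℝ) ^ 2))⁻¹ / lam⌋₊) +
            (2 * (2 * (3 * (Q : ℝ) * H₁))⁻¹ + 1) * ⌊(2 * (13 * (H₁ : ℝ) * (Q : ℝ) ^ 2))⁻¹ / lam⌋₊)))) := by
  obtain ⟨C, hC0, hC⟩ := signed_main_bound hε
  refine ⟨C, hC0, ?_⟩
  intro D L lam Λ hD hb4 hlam hΛ R Q N H₁ hR hN h2R hNQ hHQ Y₀ hY₀ M hM1 hM θ hθ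
  rw [← Finset.mul_sum]
  refine mul_le_mul_of_nonneg_left ?_ (by positivity)
  have h1 := hC D L lam Λ hD hb4 hlam hΛ 1 (Or.inl rfl) (fun q' => (q' : ℤ) + 1) (fun q' => by simp)
    R Q N H₁ hR hN h2R hNQ hHQ Y₀ hY₀ M hM1 hM θ hθ
  have h2 := hC D L lam Λ hD hb4 hlam hΛ (-1) (Or.inr rfl) (fun q' => -((q' : ℤ) + 1)) (fun q' => by ring)
    R Q N H₁ hR hN h2R hNQ hHQ Y₀ hY₀ M hM1 hM θ hθ
  beta_reduce at h1 h2
  simp_rw [sum_qhn_reindex]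
  refine le_trans (Finset.sum_le_sum fun r _ => Finset.sum_le_sum fun m _ => norm_add_le _ _) ?_
  simp only [Finset.sum_add_distrib]
  linarith

/-! ### The size of the double large sieve bound (Steps 5–7, numerically) -/

set_option maxHeartbeats 4000000 in
/-- **The numerical content of Steps 5–7 of [RS]** in the variables `t = λ^{1/13}`, `L`, `H = H₁`,
`R ≍ t⁻¹`, `Q = N ≍ t⁻³`, `M ≍ L`: the right-hand side of Lemma 4 (`RobertSargos.step567`) multiplied
by `(4LH₁/(QRN))²` is `≪_{ε,C₀} L^{4+5ε}` whenever `64 t⁻⁷ ≤ L ≤ t⁻⁸`, `1 ≤ H₁ ≤ L²t¹⁴`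
(the printed "(4·24), (4·26) into (4·21) gives (4·19)", with `M` of any size between `λ^{-7/13}` and
`λ^{-8/13}` instead of `M ≍ λ^{-8/13}`). [cite: RobertSargos2002, Steps 5–7] -/
theorem arg_numeric {C₀ C₇ ε t L H R Q N M cR lg Kr lK : ℝ} (hC₀ : 1 ≤ C₀) (hC₇ : 0 < C₇)
    (hε : 0 < ε) (ht : 0 < t) (ht1 : t ≤ 1) (hL : 64 ≤ L * t ^ 7) (hL8 : L * t ^ 8 ≤ 1) (hH1 : 1 ≤ H)
    (hH2 : H ≤ L ^ 2 * t ^ 14) (hR1 : 1 ≤ R * t) (hR2 : R * t ≤ 2) (hQ1 : 1 ≤ Q * t ^ 3)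
    (hQ2 : Q * t ^ 3 ≤ 2) (hN1 : 1 ≤ N * t ^ 3) (hN2 : N * t ^ 3 ≤ 2) (hM1 : L ≤ 4 * M) (hM2 : M ≤ L)
    (hcR0 : 0 ≤ cR) (hcR : cR ≤ 2 * R) (hlg0 : 0 ≤ lg) (hlg : lg ≤ (2 / ε + 1) * L ^ ε)
    (hKr0 : 0 ≤ Kr) (hKr : Kr ≤ 1 / (26 * H * Q ^ 2 * t ^ 13)) (hlK0 : 0 ≤ lK)
    (hlK : 1 + lK ≤ (1 / ε + 1) * L ^ ε) :
    (4 * L * H / (Q * R * N)) ^ 2 *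
      (624 ^ 2 * lg ^ 2 * cR * ((1 + 3 * Q * H) * (1 + C₀ * t ^ 13 * M * (13 * H * Q ^ 2))) *
        (C₇ * ((R * N * H * Q) ^ (1 + ε) +
          (R * N * H * Q) ^ ε * (R * N * (1 / (C₀ * t ^ 13 * M) + 4 * R * H ^ 2)))) *
        (M + 2 * (2 * C₀ * M * (2 * (3 * Q * H))⁻¹ * Kr + 2 * C₀ * t ^ 13 * M * Kr ^ 2 +
          (2 * (2 * (3 * Q * H))⁻¹ + 1) * ((2 * (3 * Q * H))⁻¹ / t ^ 13) * (1 + lK) +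
          (2 * (2 * (3 * Q * H))⁻¹ + 1) * Kr))) ≤
      (9 * (16 * 624 ^ 2 * 4 * 8 * 53 * 32) * ((2 / ε + 1) ^ 2 * (1 / ε + 1)) * C₀ ^ 2 * C₇) *
        L ^ (4 + 5 * ε) := by
  -- positivity of the basic quantities
  have ht7 : 0 < t ^ 7 := by positivity
  have hL64 : 64 ≤ L := by
    have hL0 : 0 ≤ L := by nlinarith only [hL, pow_pos ht 7]
    have : L * t ^ 7 ≤ L * 1 := mul_le_mul_of_nonneg_left (pow_le_one₀ ht.le ht1) hL0
    linarith only [hL, this]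
  have hL1 : 1 ≤ L := by linarith only [hL64]
  have hL0 : 0 < L := by linarith only [hL64]
  have hH0 : 0 < H := by linarith only [hH1]
  have hR0 : 0 < R := by nlinarith only [hR1, ht]
  have hQ0 : 0 < Q := by nlinarith only [hQ1, pow_pos ht 3]
  have hN0 : 0 < N := by nlinarith only [hN1, pow_pos ht 3]
  have hM0 : 0 < M := by linarith only [hM1, hL0]
  have hC₀0 : 0 < C₀ := by linarith only [hC₀]
  -- `t ≤ 1/64`
  have ht64 : 64 * t ≤ 1 := by nlinarith only [hL, hL8, ht.le]
  -- reciprocal forms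
  have hRle : R ≤ 2 / t := by rw [le_div_iff₀ ht]; linarith only [hR2]
  have hQle : Q ≤ 2 / t ^ 3 := by rw [le_div_iff₀ (pow_pos ht 3)]; linarith only [hQ2]
  have hNle : N ≤ 2 / t ^ 3 := by rw [le_div_iff₀ (pow_pos ht 3)]; linarith only [hN2]
  -- `F1 : H t² ≤ 1`, `F3 : L t⁸ ≤ 1`
  have F1 : H * t ^ 2 ≤ 1 := by
    calc H * t ^ 2 ≤ L ^ 2 * t ^ 14 * t ^ 2 := mul_le_mul_of_nonneg_right hH2 (by positivity)
      _ = (L * t ^ 8) ^ 2 := by ring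
      _ ≤ 1 := pow_le_one₀ (by positivity) hL8
  have hHt2 : H ≤ 1 / t ^ 2 := by rw [le_div_iff₀ (by positivity)]; exact F1
  have hHt7 : H ≤ L := by
    -- `H ≤ t⁻² ≤ t⁻⁷ ≤ L/64 ≤ L`
    have h1 : H * t ^ 7 ≤ 1 := by
      calc H * t ^ 7 = H * t ^ 2 * t ^ 5 := by ring
        _ ≤ 1 * 1 := mul_le_mul F1 (pow_le_one₀ ht.le ht1) (by positivity) zero_le_one
        _ = 1 := one_mul _
    nlinarith only [h1, hL, pow_pos ht 7]
  -- (F) `(4LH/(QRN))² ≤ 16 L² H² t¹⁴`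
  have hF : 4 * L * H / (Q * R * N) ≤ 4 * L * H * t ^ 7 := by
    rw [div_le_iff₀ (by positivity)]
    have : 1 ≤ t ^ 7 * (Q * R * N) := by
      calc (1 : ℝ) = 1 * 1 * 1 := by ring
        _ ≤ (Q * t ^ 3) * (R * t) * (N * t ^ 3) :=
            mul_le_mul (mul_le_mul hQ1 hR1 zero_le_one (by positivity)) hN1 zero_le_one (by positivity)
        _ = t ^ 7 * (Q * R * N) := by ring
    calc 4 * L * H = 4 * L * H * 1 := by ring
      _ ≤ 4 * L * H * (t ^ 7 * (Q * R * N)) := mul_le_mul_of_nonneg_left this (by positivity)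
      _ = 4 * L * H * t ^ 7 * (Q * R * N) := by ring
  have hF0 : 0 ≤ 4 * L * H / (Q * R * N) := by positivity
  have hF2 : (4 * L * H / (Q * R * N)) ^ 2 ≤ 16 * L ^ 2 * H ^ 2 * t ^ 14 := by
    calc _ ≤ (4 * L * H * t ^ 7) ^ 2 := pow_le_pow_left₀ hF0 hF 2
      _ = _ := by ring
  -- (G1) the logarithm
  have hG1 : 624 ^ 2 * lg ^ 2 ≤ 624 ^ 2 * ((2 / ε + 1) ^ 2 * L ^ (2 * ε)) := by
    refine mul_le_mul_of_nonneg_left ?_ (by positivity)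
    calc lg ^ 2 ≤ ((2 / ε + 1) * L ^ ε) ^ 2 := pow_le_pow_left₀ hlg0 hlg 2
      _ = (2 / ε + 1) ^ 2 * (L ^ ε * L ^ ε) := by ring
      _ = (2 / ε + 1) ^ 2 * L ^ (2 * ε) := by rw [← Real.rpow_add hL0]; ring_nf
  -- (G2) the number of `r`
  have hG2 : cR ≤ 4 / t := by
    calc cR ≤ 2 * R := hcR
      _ ≤ 2 * (2 / t) := by linarith only [hRle]
      _ = 4 / t := by ring
  -- (G3) `1 + X₁`
  have hG3 : 1 + 3 * Q * H ≤ 8 * H / t ^ 3 := by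
    rw [le_div_iff₀ (pow_pos ht 3)]
    have h1 : t ^ 3 ≤ 1 := pow_le_one₀ ht.le ht1
    nlinarith only [h1, hQ2, hH1, hH0.le]
  -- (G4) `1 + μX₂`
  have hG4 : 1 + C₀ * t ^ 13 * M * (13 * H * Q ^ 2) ≤ 53 * C₀ * t ^ 7 * L * H := by
    have h1 : 1 ≤ C₀ * t ^ 7 * L * H := by
      calc (1 : ℝ) ≤ 1 * 64 * 1 := by norm_num
        _ ≤ C₀ * (L * t ^ 7) * H := mul_le_mul (mul_le_mul hC₀ hL (by norm_num) hC₀0.le) hH1 zero_le_one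
            (by positivity)
        _ = C₀ * t ^ 7 * L * H := by ring
    have h2 : C₀ * t ^ 13 * M * (13 * H * Q ^ 2) ≤ 52 * C₀ * t ^ 7 * L * H := by
      calc C₀ * t ^ 13 * M * (13 * H * Q ^ 2) = 13 * C₀ * t ^ 7 * H * M * (Q * t ^ 3) ^ 2 := by ring
        _ ≤ 13 * C₀ * t ^ 7 * H * L * 2 ^ 2 := by
            refine mul_le_mul (mul_le_mul_of_nonneg_left hM2 (by positivity))
              (pow_le_pow_left₀ (by positivity) hQ2 2) (by positivity) (by positivity)
        _ = 52 * C₀ * t ^ 7 * L * H := by ring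
    linarith only [h1, h2]
  -- (G5) the count `𝒩`
  set X : ℝ := R * N * H * Q with hX
  have hX0 : 0 < X := by positivity
  have hXle : X ≤ 8 * H / t ^ 7 := by
    rw [le_div_iff₀ ht7]
    calc X * t ^ 7 = (R * t) * (N * t ^ 3) * (Q * t ^ 3) * H := by rw [hX]; ring
      _ ≤ 2 * 2 * 2 * H := by
          refine mul_le_mul_of_nonneg_right ?_ hH0.le
          exact mul_le_mul (mul_le_mul hR2 hN2 (by positivity) (by norm_num)) hQ2 (by positivity)
            (by norm_num)
      _ = 8 * H := by ring
  have hXL : X ≤ L ^ 2 := by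
    refine hXle.trans ?_
    rw [div_le_iff₀ ht7]
    -- `8H t² ≤ 8 ≤ 4096 ≤ (Lt⁷)(Lt²) = L²t⁹`
    have hLt2 : 64 ≤ L * t ^ 2 := by
      have : L * t ^ 7 ≤ L * t ^ 2 :=
        mul_le_mul_of_nonneg_left (pow_le_pow_of_le_one ht.le ht1 (by norm_num)) hL0.le
      linarith only [hL, this]
    have k1 : 8 * H * t ^ 2 ≤ L ^ 2 * t ^ 7 * t ^ 2 := by nlinarith only [F1, hL, hLt2]
    exact le_of_mul_le_mul_right k1 (pow_pos ht 2)
  have hXε : X ^ ε ≤ L ^ (2 * ε) := by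
    calc X ^ ε ≤ (L ^ 2) ^ ε := Real.rpow_le_rpow hX0.le hXL hε.le
      _ = L ^ (2 * ε) := by rw [← Real.rpow_natCast, ← Real.rpow_mul hL0.le]; norm_num
  have hG5 : C₇ * (X ^ (1 + ε) + X ^ ε * (R * N * (1 / (C₀ * t ^ 13 * M) + 4 * R * H ^ 2))) ≤
      32 * C₇ * L ^ (2 * ε) * (H / t ^ 7 + 1 / (t ^ 17 * L) + H ^ 2 / t ^ 5) := by
    have e1 : X ^ (1 + ε) = X * X ^ ε := by rw [Real.rpow_add hX0, Real.rpow_one]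
    have hRN : R * N ≤ 4 / t ^ 4 := by
      rw [le_div_iff₀ (by positivity)]
      calc R * N * t ^ 4 = (R * t) * (N * t ^ 3) := by ring
        _ ≤ 2 * 2 := mul_le_mul hR2 hN2 (by positivity) (by norm_num)
        _ = 4 := by norm_num
    have hμ : 1 / (C₀ * t ^ 13 * M) ≤ 4 / (t ^ 13 * L) := by
      rw [div_le_div_iff₀ (by positivity) (by positivity)]
      calc 1 * (t ^ 13 * L) ≤ C₀ * (t ^ 13 * (4 * M)) := by
            refine mul_le_mul hC₀ (mul_le_mul_of_nonneg_left hM1 (by positivity)) (by positivity) hC₀0.le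
        _ = 4 * (C₀ * t ^ 13 * M) := by ring
    have hb : R * N * (1 / (C₀ * t ^ 13 * M)) ≤ 16 * (1 / (t ^ 17 * L)) := by
      calc R * N * (1 / (C₀ * t ^ 13 * M)) ≤ (4 / t ^ 4) * (4 / (t ^ 13 * L)) :=
            mul_le_mul hRN hμ (by positivity) (by positivity)
        _ = 16 * (1 / (t ^ 17 * L)) := by field_simp; ring
    have hc : R * N * (4 * R * H ^ 2) ≤ 32 * (H ^ 2 / t ^ 5) := by
      rw [show R * N * (4 * R * H ^ 2) = 4 * (R * (R * N)) * H ^ 2 by ring, mul_div_assoc']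
      rw [le_div_iff₀ (by positivity)]
      calc 4 * (R * (R * N)) * H ^ 2 * t ^ 5 = 4 * ((R * t) * ((R * t) * (N * t ^ 3))) * H ^ 2 := by ring
        _ ≤ 4 * (2 * (2 * 2)) * H ^ 2 := by
            refine mul_le_mul_of_nonneg_right (mul_le_mul_of_nonneg_left ?_ (by norm_num)) (by positivity)
            exact mul_le_mul hR2 (mul_le_mul hR2 hN2 (by positivity) (by norm_num)) (by positivity) (by norm_num)
        _ = 32 * H ^ 2 := by ring
    have ha : X ≤ 8 * (H / t ^ 7) := by rw [mul_div_assoc']; exact hXle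
    have hsum : X + R * N * (1 / (C₀ * t ^ 13 * M) + 4 * R * H ^ 2) ≤
        32 * (H / t ^ 7 + 1 / (t ^ 17 * L) + H ^ 2 / t ^ 5) := by
      rw [mul_add]
      have ha0 : 0 ≤ H / t ^ 7 := by positivity
      have hb0 : 0 ≤ 1 / (t ^ 17 * L) := by positivity
      linarith only [ha, hb, hc, ha0, hb0]
    calc C₇ * (X ^ (1 + ε) + X ^ ε * (R * N * (1 / (C₀ * t ^ 13 * M) + 4 * R * H ^ 2)))
        = C₇ * (X ^ ε * (X + R * N * (1 / (C₀ * t ^ 13 * M) + 4 * R * H ^ 2))) := by rw [e1]; ring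
      _ ≤ C₇ * (L ^ (2 * ε) * (32 * (H / t ^ 7 + 1 / (t ^ 17 * L) + H ^ 2 / t ^ 5))) := by
          refine mul_le_mul_of_nonneg_left ?_ hC₇.le
          exact mul_le_mul hXε hsum (by positivity) (by positivity)
      _ = _ := by ring
  -- (G6) the count `ℬ`
  have hG6 : M + 2 * (2 * C₀ * M * (2 * (3 * Q * H))⁻¹ * Kr + 2 * C₀ * t ^ 13 * M * Kr ^ 2 +
        (2 * (2 * (3 * Q * H))⁻¹ + 1) * ((2 * (3 * Q * H))⁻¹ / t ^ 13) * (1 + lK) +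
        (2 * (2 * (3 * Q * H))⁻¹ + 1) * Kr) ≤
      C₀ * ((1 / ε + 1) * L ^ ε) * (L + L / (t ^ 4 * H ^ 2) + 1 / (t ^ 10 * H)) := by
    have hX1 : (2 * (3 * Q * H))⁻¹ ≤ t ^ 3 / (6 * H) := by
      rw [inv_le_comm₀ (by positivity) (by positivity), inv_div, div_le_iff₀ (pow_pos ht 3)]
      nlinarith only [hQ1, hH0.le]
    have hX1' : (2 * (3 * Q * H))⁻¹ ≤ 1 / 6 := by
      refine hX1.trans ?_
      rw [div_le_div_iff₀ (by positivity) (by norm_num)]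
      have : t ^ 3 ≤ 1 := pow_le_one₀ ht.le ht1
      linarith only [this, hH1]
    have hX10 : 0 ≤ (2 * (3 * Q * H))⁻¹ := by positivity
    have hKr' : Kr ≤ 1 / (26 * H * t ^ 7) := by
      refine hKr.trans ?_
      rw [div_le_div_iff₀ (by positivity) (by positivity), one_mul, one_mul]
      calc 26 * H * t ^ 7 ≤ 26 * H * t ^ 7 * (Q * t ^ 3) ^ 2 := by
            have : 1 ≤ (Q * t ^ 3) ^ 2 := one_le_pow₀ hQ1
            have h0 : 0 ≤ 26 * H * t ^ 7 := by positivity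
            nlinarith only [this, h0]
        _ = 26 * H * Q ^ 2 * t ^ 13 := by ring
    have h13 : 2 * (2 * (3 * Q * H))⁻¹ + 1 ≤ 4 / 3 := by linarith only [hX1']
    have hT1 : 2 * C₀ * M * (2 * (3 * Q * H))⁻¹ * Kr ≤ C₀ * (L / (t ^ 4 * H ^ 2)) / 78 := by
      calc 2 * C₀ * M * (2 * (3 * Q * H))⁻¹ * Kr ≤ 2 * C₀ * L * (t ^ 3 / (6 * H)) * (1 / (26 * H * t ^ 7)) := by
            refine mul_le_mul (mul_le_mul (mul_le_mul_of_nonneg_left hM2 (by positivity)) hX1 hX10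
              (by positivity)) hKr' hKr0 (by positivity)
        _ = C₀ * (L / (t ^ 4 * H ^ 2)) / 78 := by field_simp; ring
    have hT2 : 2 * C₀ * t ^ 13 * M * Kr ^ 2 ≤ C₀ * (L / (t ^ 4 * H ^ 2)) / 338 := by
      calc 2 * C₀ * t ^ 13 * M * Kr ^ 2 ≤ 2 * C₀ * t ^ 13 * L * (1 / (26 * H * t ^ 7)) ^ 2 := by
            refine mul_le_mul (mul_le_mul_of_nonneg_left hM2 (by positivity))
              (pow_le_pow_left₀ hKr0 hKr' 2) (by positivity) (by positivity)
        _ = C₀ * (L / (t ^ 4 * H ^ 2)) / 338 * t ^ 3 := by field_simp; ring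
        _ ≤ C₀ * (L / (t ^ 4 * H ^ 2)) / 338 * 1 :=
            mul_le_mul_of_nonneg_left (pow_le_one₀ ht.le ht1) (by positivity)
        _ = _ := mul_one _
    have hT3 : (2 * (2 * (3 * Q * H))⁻¹ + 1) * ((2 * (3 * Q * H))⁻¹ / t ^ 13) * (1 + lK) ≤
        (2 / 9) * (1 / (t ^ 10 * H)) * (1 + lK) := by
      refine mul_le_mul_of_nonneg_right ?_ (by positivity)
      calc (2 * (2 * (3 * Q * H))⁻¹ + 1) * ((2 * (3 * Q * H))⁻¹ / t ^ 13)
          ≤ (4 / 3) * ((t ^ 3 / (6 * H)) / t ^ 13) :=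
            mul_le_mul h13 (div_le_div_of_nonneg_right hX1 (by positivity)) (by positivity) (by norm_num)
        _ = (2 / 9) * (1 / (t ^ 10 * H)) := by field_simp; ring
    have hT4 : (2 * (2 * (3 * Q * H))⁻¹ + 1) * Kr ≤ (2 / 39) * (1 / (t ^ 10 * H)) := by
      calc (2 * (2 * (3 * Q * H))⁻¹ + 1) * Kr ≤ (4 / 3) * (1 / (26 * H * t ^ 7)) :=
            mul_le_mul h13 hKr' hKr0 (by norm_num)
        _ = (2 / 39) * (1 / (t ^ 10 * H)) * t ^ 3 := by field_simp; ring
        _ ≤ (2 / 39) * (1 / (t ^ 10 * H)) * 1 :=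
            mul_le_mul_of_nonneg_left (pow_le_one₀ ht.le ht1) (by positivity)
        _ = _ := mul_one _
    have hlK1 : 1 ≤ 1 + lK := by linarith only [hlK0]
    have hA0 : 0 ≤ L / (t ^ 4 * H ^ 2) := by positivity
    have hB0 : 0 ≤ 1 / (t ^ 10 * H) := by positivity
    have hLε1 : 1 ≤ (1 / ε + 1) * L ^ ε := hlK1.trans hlK
    -- `M + 2(T1+T2+T3+T4) ≤ (1+lK) C₀ (L + L/(t⁴H²) + 1/(t¹⁰H))`
    have step1 : M + 2 * (2 * C₀ * M * (2 * (3 * Q * H))⁻¹ * Kr + 2 * C₀ * t ^ 13 * M * Kr ^ 2 +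
        (2 * (2 * (3 * Q * H))⁻¹ + 1) * ((2 * (3 * Q * H))⁻¹ / t ^ 13) * (1 + lK) +
        (2 * (2 * (3 * Q * H))⁻¹ + 1) * Kr) ≤
        (1 + lK) * C₀ * (L + L / (t ^ 4 * H ^ 2) + 1 / (t ^ 10 * H)) := by
      have e0 : (1 + lK) * C₀ * (L + L / (t ^ 4 * H ^ 2) + 1 / (t ^ 10 * H)) =
          (1 + lK) * C₀ * L + (1 + lK) * C₀ * (L / (t ^ 4 * H ^ 2)) + (1 + lK) * C₀ * (1 / (t ^ 10 * H)) := by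
        ring
      rw [e0]
      have i1 : M ≤ (1 + lK) * C₀ * L := by
        calc M ≤ L := hM2
          _ = 1 * 1 * L := by ring
          _ ≤ (1 + lK) * C₀ * L := mul_le_mul_of_nonneg_right (mul_le_mul hlK1 hC₀ zero_le_one (by positivity)) hL0.le
      have i2 : 2 * (2 * C₀ * M * (2 * (3 * Q * H))⁻¹ * Kr + 2 * C₀ * t ^ 13 * M * Kr ^ 2) ≤
          (1 + lK) * C₀ * (L / (t ^ 4 * H ^ 2)) := by
        have : 2 * (C₀ * (L / (t ^ 4 * H ^ 2)) / 78 + C₀ * (L / (t ^ 4 * H ^ 2)) / 338) ≤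
            1 * C₀ * (L / (t ^ 4 * H ^ 2)) := by linarith only [mul_nonneg hC₀0.le hA0]
        have h2 : 1 * C₀ * (L / (t ^ 4 * H ^ 2)) ≤ (1 + lK) * C₀ * (L / (t ^ 4 * H ^ 2)) :=
          mul_le_mul_of_nonneg_right (mul_le_mul_of_nonneg_right hlK1 hC₀0.le) hA0
        linarith only [hT1, hT2, this, h2]
      have i3 : 2 * ((2 * (2 * (3 * Q * H))⁻¹ + 1) * ((2 * (3 * Q * H))⁻¹ / t ^ 13) * (1 + lK) +
          (2 * (2 * (3 * Q * H))⁻¹ + 1) * Kr) ≤ (1 + lK) * C₀ * (1 / (t ^ 10 * H)) := by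
        have : 2 * ((2 / 9) * (1 / (t ^ 10 * H)) * (1 + lK) + (2 / 39) * (1 / (t ^ 10 * H))) ≤
            (1 + lK) * 1 * (1 / (t ^ 10 * H)) := by linarith only [hB0, mul_nonneg hB0 hlK0]
        have h2 : (1 + lK) * 1 * (1 / (t ^ 10 * H)) ≤ (1 + lK) * C₀ * (1 / (t ^ 10 * H)) :=
          mul_le_mul_of_nonneg_right (mul_le_mul_of_nonneg_left hC₀ (by positivity)) hB0
        linarith only [hT3, hT4, this, h2]
      linarith only [i1, i2, i3]
    calc _ ≤ (1 + lK) * C₀ * (L + L / (t ^ 4 * H ^ 2) + 1 / (t ^ 10 * H)) := step1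
      _ ≤ ((1 / ε + 1) * L ^ ε) * C₀ * (L + L / (t ^ 4 * H ^ 2) + 1 / (t ^ 10 * H)) := by
          refine mul_le_mul_of_nonneg_right (mul_le_mul_of_nonneg_right hlK hC₀0.le) (by positivity)
      _ = _ := by ring
  -- the polynomial core
  have hcore := poly_core ht hL1 hH1 F1 hH2 hL8
  have hmono : L ^ 3 * H ^ 4 * t ^ 17 * ((H / t ^ 7 + 1 / (t ^ 17 * L) + H ^ 2 / t ^ 5) *
      (L + L / (t ^ 4 * H ^ 2) + 1 / (t ^ 10 * H))) ≤ 9 * L ^ 4 := by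
    have e1 : L ^ 3 * H ^ 4 * t ^ 17 * ((H / t ^ 7 + 1 / (t ^ 17 * L) + H ^ 2 / t ^ 5) *
        (L + L / (t ^ 4 * H ^ 2) + 1 / (t ^ 10 * H))) =
        L ^ 2 * ((t ^ 10 * H ^ 5 * L + H ^ 4 + t ^ 12 * H ^ 6 * L) * (L * t ^ 10 * H ^ 2 + L * t ^ 6 + H)) /
          (t ^ 10 * H ^ 2) := by
      field_simp
    rw [e1, div_le_iff₀ (by positivity)]
    calc L ^ 2 * ((t ^ 10 * H ^ 5 * L + H ^ 4 + t ^ 12 * H ^ 6 * L) * (L * t ^ 10 * H ^ 2 + L * t ^ 6 + H))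
        ≤ L ^ 2 * (9 * (L ^ 2 * t ^ 10 * H ^ 2)) := mul_le_mul_of_nonneg_left hcore (by positivity)
      _ = 9 * L ^ 4 * (t ^ 10 * H ^ 2) := by ring
  -- powers of `L`
  have hLpow : L ^ (2 * ε) * L ^ (2 * ε) * L ^ ε * L ^ 4 = L ^ (4 + 5 * ε) := by
    rw [← Real.rpow_natCast L 4, ← Real.rpow_add hL0, ← Real.rpow_add hL0, ← Real.rpow_add hL0]
    norm_num; ring_nf
  -- assembling
  have hP0 : 0 ≤ (H / t ^ 7 + 1 / (t ^ 17 * L) + H ^ 2 / t ^ 5) := by positivity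
  have hP1 : 0 ≤ (L + L / (t ^ 4 * H ^ 2) + 1 / (t ^ 10 * H)) := by positivity
  have hG50 : 0 ≤ C₇ * (X ^ (1 + ε) + X ^ ε * (R * N * (1 / (C₀ * t ^ 13 * M) + 4 * R * H ^ 2))) := by
    positivity
  have hG34 : (1 + 3 * Q * H) * (1 + C₀ * t ^ 13 * M * (13 * H * Q ^ 2)) ≤
      (8 * H / t ^ 3) * (53 * C₀ * t ^ 7 * L * H) := mul_le_mul hG3 hG4 (by positivity) (by positivity)
  have hG12 : 624 ^ 2 * lg ^ 2 * cR ≤ 624 ^ 2 * ((2 / ε + 1) ^ 2 * L ^ (2 * ε)) * (4 / t) :=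
    mul_le_mul hG1 hG2 hcR0 (by positivity)
  have hG1234 : 624 ^ 2 * lg ^ 2 * cR * ((1 + 3 * Q * H) * (1 + C₀ * t ^ 13 * M * (13 * H * Q ^ 2))) ≤
      624 ^ 2 * ((2 / ε + 1) ^ 2 * L ^ (2 * ε)) * (4 / t) * ((8 * H / t ^ 3) * (53 * C₀ * t ^ 7 * L * H)) :=
    mul_le_mul hG12 hG34 (by positivity) (by positivity)
  have hG12345 : 624 ^ 2 * lg ^ 2 * cR * ((1 + 3 * Q * H) * (1 + C₀ * t ^ 13 * M * (13 * H * Q ^ 2))) *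
      (C₇ * (X ^ (1 + ε) + X ^ ε * (R * N * (1 / (C₀ * t ^ 13 * M) + 4 * R * H ^ 2)))) ≤
      624 ^ 2 * ((2 / ε + 1) ^ 2 * L ^ (2 * ε)) * (4 / t) * ((8 * H / t ^ 3) * (53 * C₀ * t ^ 7 * L * H)) *
        (32 * C₇ * L ^ (2 * ε) * (H / t ^ 7 + 1 / (t ^ 17 * L) + H ^ 2 / t ^ 5)) :=
    mul_le_mul hG1234 hG5 hG50 (by positivity)
  have hBv0 : 0 ≤ M + 2 * (2 * C₀ * M * (2 * (3 * Q * H))⁻¹ * Kr + 2 * C₀ * t ^ 13 * M * Kr ^ 2 +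
      (2 * (2 * (3 * Q * H))⁻¹ + 1) * ((2 * (3 * Q * H))⁻¹ / t ^ 13) * (1 + lK) +
      (2 * (2 * (3 * Q * H))⁻¹ + 1) * Kr) := by positivity
  have hall : 624 ^ 2 * lg ^ 2 * cR * ((1 + 3 * Q * H) * (1 + C₀ * t ^ 13 * M * (13 * H * Q ^ 2))) *
      (C₇ * (X ^ (1 + ε) + X ^ ε * (R * N * (1 / (C₀ * t ^ 13 * M) + 4 * R * H ^ 2)))) *
      (M + 2 * (2 * C₀ * M * (2 * (3 * Q * H))⁻¹ * Kr + 2 * C₀ * t ^ 13 * M * Kr ^ 2 +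
        (2 * (2 * (3 * Q * H))⁻¹ + 1) * ((2 * (3 * Q * H))⁻¹ / t ^ 13) * (1 + lK) +
        (2 * (2 * (3 * Q * H))⁻¹ + 1) * Kr)) ≤
      624 ^ 2 * ((2 / ε + 1) ^ 2 * L ^ (2 * ε)) * (4 / t) * ((8 * H / t ^ 3) * (53 * C₀ * t ^ 7 * L * H)) *
        (32 * C₇ * L ^ (2 * ε) * (H / t ^ 7 + 1 / (t ^ 17 * L) + H ^ 2 / t ^ 5)) *
        (C₀ * ((1 / ε + 1) * L ^ ε) * (L + L / (t ^ 4 * H ^ 2) + 1 / (t ^ 10 * H))) :=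
    mul_le_mul hG12345 hG6 hBv0 (by positivity)
  have hall0 : 0 ≤ 624 ^ 2 * lg ^ 2 * cR * ((1 + 3 * Q * H) * (1 + C₀ * t ^ 13 * M * (13 * H * Q ^ 2))) *
      (C₇ * (X ^ (1 + ε) + X ^ ε * (R * N * (1 / (C₀ * t ^ 13 * M) + 4 * R * H ^ 2)))) *
      (M + 2 * (2 * C₀ * M * (2 * (3 * Q * H))⁻¹ * Kr + 2 * C₀ * t ^ 13 * M * Kr ^ 2 +
        (2 * (2 * (3 * Q * H))⁻¹ + 1) * ((2 * (3 * Q * H))⁻¹ / t ^ 13) * (1 + lK) +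
        (2 * (2 * (3 * Q * H))⁻¹ + 1) * Kr)) := by positivity
  calc _ ≤ (16 * L ^ 2 * H ^ 2 * t ^ 14) *
        (624 ^ 2 * ((2 / ε + 1) ^ 2 * L ^ (2 * ε)) * (4 / t) * ((8 * H / t ^ 3) * (53 * C₀ * t ^ 7 * L * H)) *
        (32 * C₇ * L ^ (2 * ε) * (H / t ^ 7 + 1 / (t ^ 17 * L) + H ^ 2 / t ^ 5)) *
        (C₀ * ((1 / ε + 1) * L ^ ε) * (L + L / (t ^ 4 * H ^ 2) + 1 / (t ^ 10 * H)))) :=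
        mul_le_mul hF2 hall hall0 (by positivity)
    _ = ((16 * 624 ^ 2 * 4 * 8 * 53 * 32) * ((2 / ε + 1) ^ 2 * (1 / ε + 1)) * C₀ ^ 2 * C₇) *
        (L ^ (2 * ε) * L ^ (2 * ε) * L ^ ε) *
        (L ^ 3 * H ^ 4 * t ^ 17 * ((H / t ^ 7 + 1 / (t ^ 17 * L) + H ^ 2 / t ^ 5) *
          (L + L / (t ^ 4 * H ^ 2) + 1 / (t ^ 10 * H)))) := by
        field_simp
    _ ≤ ((16 * 624 ^ 2 * 4 * 8 * 53 * 32) * ((2 / ε + 1) ^ 2 * (1 / ε + 1)) * C₀ ^ 2 * C₇) *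
        (L ^ (2 * ε) * L ^ (2 * ε) * L ^ ε) * (9 * L ^ 4) :=
        mul_le_mul_of_nonneg_left hmono (by positivity)
    _ = _ := by rw [← hLpow]; ring

/-! ### Helpers for the degenerate terms of Step 2 -/

/-- `∑_{0<|q|<Q} 1/√|q| ≤ 4√Q`. [folklore] -/
theorem sum_inv_sqrt_abs_le (Q : ℕ) :
    ∑ q ∈ (Finset.Ioo (-(Q : ℤ)) Q).erase 0, 1 / Real.sqrt |(q : ℝ)| ≤ 4 * Real.sqrt Q := by
  rw [sum_erase_zero_eq (fun q : ℤ => 1 / Real.sqrt |(q : ℝ)|) Q]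
  have h1 : ∀ q' : ℕ, 1 / Real.sqrt |(((q' : ℤ) + 1 : ℤ) : ℝ)| = 1 / Real.sqrt ((q' : ℝ) + 1) := by
    intro q'; push_cast; rw [abs_of_nonneg (by positivity)]
  have h2 : ∀ q' : ℕ, 1 / Real.sqrt |((-((q' : ℤ) + 1) : ℤ) : ℝ)| = 1 / Real.sqrt ((q' : ℝ) + 1) := by
    intro q'; push_cast; rw [abs_neg, abs_of_nonneg (by positivity)]
  simp only [h1, h2]
  have h3 := sum_inv_sqrt_le (Q - 1)
  have h4 : Real.sqrt ((Q - 1 : ℕ) : ℝ) ≤ Real.sqrt Q :=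
    Real.sqrt_le_sqrt (by exact_mod_cast Nat.sub_le Q 1)
  linarith

/-- `y^{1/6} ≤ Z` when `0 ≤ y ≤ Z⁶`, `0 ≤ Z`. [folklore] -/
theorem rpow_sixth_le {y Z : ℝ} (hy : 0 ≤ y) (hZ : 0 ≤ Z) (h : y ≤ Z ^ 6) : y ^ (1 / 6 : ℝ) ≤ Z := by
  calc y ^ (1 / 6 : ℝ) ≤ (Z ^ 6) ^ (1 / 6 : ℝ) := Real.rpow_le_rpow hy h (by norm_num)
    _ = Z := by
        rw [show (1 / 6 : ℝ) = ((6 : ℕ) : ℝ)⁻¹ by norm_num]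
        exact Real.pow_rpow_inv_natCast hZ (by norm_num)

/-- `y^{-1/6} ≤ Z` when `0 < y`, `0 < Z` and `1 ≤ Z⁶ y`. [folklore] -/
theorem rpow_neg_sixth_le {y Z : ℝ} (hy : 0 < y) (hZ : 0 < Z) (h : 1 ≤ Z ^ 6 * y) :
    y ^ (-(1 / 6 : ℝ)) ≤ Z := by
  rw [Real.rpow_neg hy.le]
  have h1 : y⁻¹ ≤ Z ^ 6 := by rw [inv_le_iff_one_le_mul₀ hy]; linarith [h]
  have h2 : (y ^ (1 / 6 : ℝ))⁻¹ = (y⁻¹) ^ (1 / 6 : ℝ) := (Real.inv_rpow hy.le _).symm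
  rw [h2]
  exact rpow_sixth_le (by positivity) hZ.le h1


/-! ### The bound for `S(H₁)` when `H₁ ≥ 2R` -/

set_option maxHeartbeats 8000000 in
open Classical in
/-- **Steps 2–7 of [RS] for one dyadic piece with `H₁ ≥ 2R`**, in the variables `t = λ^{1/13}`
(`t¹³ ≤ f⁗ ≤ C₀t¹³` on `[0, L]`): for `64 t⁻⁷ ≤ L ≤ t⁻⁸`, `H₁ ≤ L²t¹⁴`, `H₁ ≥ 2R` (`R = ⌈t⁻¹⌉`,
`Q = N = ⌈t⁻³⌉`), `S(H₁)² ≤ C(ε, C₀) L^{2+3ε}` — the estimate (4·7). Assembled from `step23`, the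
numerics of the degenerate terms, `main_term_bound` and `arg_numeric`.
[cite: RobertSargos2002, §4, (4.7)–(4.26)] -/
theorem large_block_bound (C₀ : ℝ) (hC₀ : 1 ≤ C₀) {ε : ℝ} (hε : 0 < ε) : ∃ C : ℝ, 0 < C ∧
    ∀ (t : ℝ), 0 < t → t ≤ 1 →
    ∀ (L : ℕ), (64 : ℝ) ≤ L * t ^ 7 → (L : ℝ) * t ^ 8 ≤ 1 →
    ∀ (D : ℕ → ℝ → ℝ), DerivFamily D 0 L 4 →
      (∀ x ∈ Set.Icc (0 : ℝ) L, t ^ 13 ≤ D 4 x ∧ D 4 x ≤ C₀ * t ^ 13) →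
    ∀ (H₁ : ℕ), (H₁ : ℝ) ≤ (L : ℝ) ^ 2 * t ^ 14 → 2 * ⌈t⁻¹⌉₊ ≤ H₁ →
      (∑ h ∈ Finset.Ico (H₁ : ℤ) (2 * H₁),
        ‖∑ n ∈ Finset.Ioc h ((L : ℤ) - h), e (D 0 ((n : ℝ) + h) - D 0 ((n : ℝ) - h))‖) ^ 2 ≤
        C * (L : ℝ) ^ (2 + 3 * ε) := by
  obtain ⟨C₇, hC₇0, hC₇⟩ := main_term_bound hε
  set CONST : ℝ := (9 * (16 * 624 ^ 2 * 4 * 8 * 53 * 32) * ((2 / ε + 1) ^ 2 * (1 / ε + 1)) * C₀ ^ 2 * C₇)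
    with hCONST
  set K₀ : ℝ := 262144 * C₀ with hK₀
  set Du₀ : ℝ := 1 + 7 * K₀ + 200 * K₀ ^ 2 + 250 * K₀ ^ 3 with hDu₀
  have hCONST0 : 0 < CONST := by rw [hCONST]; positivity
  refine ⟨43 + 5184 * C₀ + 16 * Du₀ * Real.sqrt CONST, by positivity, ?_⟩
  intro t ht ht1 L hL hL8 D hD hb4 H₁ hH2 hHR
  -- the parameters `R = ⌈1/t⌉`, `Q = N = ⌈1/t³⌉`
  set R : ℕ := ⌈t⁻¹⌉₊ with hRdef
  set Q : ℕ := ⌈(t ^ 3)⁻¹⌉₊ with hQdef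
  have hC₀0 : 0 < C₀ := by linarith
  have ht3 : 0 < t ^ 3 := pow_pos ht 3
  have ht7 : 0 < t ^ 7 := pow_pos ht 7
  have hti : 1 ≤ t⁻¹ := one_le_inv_iff₀.mpr ⟨ht, ht1⟩
  have ht31 : t ^ 3 ≤ 1 := pow_le_one₀ ht.le ht1
  have ht3i : 1 ≤ (t ^ 3)⁻¹ := one_le_inv_iff₀.mpr ⟨ht3, ht31⟩
  have hRr1 : t⁻¹ ≤ R := Nat.le_ceil _
  have hRr2 : (R : ℝ) < t⁻¹ + 1 := Nat.ceil_lt_add_one (by positivity)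
  have hQr1 : (t ^ 3)⁻¹ ≤ Q := Nat.le_ceil _
  have hQr2 : (Q : ℝ) < (t ^ 3)⁻¹ + 1 := Nat.ceil_lt_add_one (by positivity)
  have hRt1 : 1 ≤ (R : ℝ) * t := by
    have := mul_le_mul_of_nonneg_right hRr1 ht.le; rwa [inv_mul_cancel₀ ht.ne'] at this
  have hRt2 : (R : ℝ) * t ≤ 2 := by
    have h1 : (R : ℝ) * t ≤ (t⁻¹ + 1) * t := mul_le_mul_of_nonneg_right hRr2.le ht.le
    rw [add_mul, inv_mul_cancel₀ ht.ne'] at h1; linarith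
  have hQt1 : 1 ≤ (Q : ℝ) * t ^ 3 := by
    have := mul_le_mul_of_nonneg_right hQr1 ht3.le; rwa [inv_mul_cancel₀ ht3.ne'] at this
  have hQt2 : (Q : ℝ) * t ^ 3 ≤ 2 := by
    have h1 : (Q : ℝ) * t ^ 3 ≤ ((t ^ 3)⁻¹ + 1) * t ^ 3 := mul_le_mul_of_nonneg_right hQr2.le ht3.le
    rw [add_mul, inv_mul_cancel₀ ht3.ne'] at h1; linarith
  have hR1r : (1 : ℝ) ≤ R := le_trans hti hRr1
  have hQ1r : (1 : ℝ) ≤ Q := le_trans ht3i hQr1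
  have hR1 : 1 ≤ R := by exact_mod_cast hR1r
  have hQ1 : 1 ≤ Q := by exact_mod_cast hQ1r
  have hR0 : (0 : ℝ) < R := by linarith
  have hQ0 : (0 : ℝ) < Q := by linarith
  have hL64 : (64 : ℝ) ≤ L := by
    have : (L : ℝ) * t ^ 7 ≤ L * 1 := mul_le_mul_of_nonneg_left (pow_le_one₀ ht.le ht1) (by positivity)
    linarith
  have hL1 : (1 : ℝ) ≤ L := by linarith
  have hL0 : (0 : ℝ) < L := by linarith
  have ht64 : 64 * t ≤ 1 := by nlinarith only [hL, hL8, ht.le]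
  have hRle : (R : ℝ) ≤ 2 / t := by rw [le_div_iff₀ ht]; exact hRt2
  have hQle : (Q : ℝ) ≤ 2 / t ^ 3 := by rw [le_div_iff₀ ht3]; exact hQt2
  have F1 : (H₁ : ℝ) * t ^ 2 ≤ 1 := by
    calc (H₁ : ℝ) * t ^ 2 ≤ (L : ℝ) ^ 2 * t ^ 14 * t ^ 2 := mul_le_mul_of_nonneg_right hH2 (by positivity)
      _ = ((L : ℝ) * t ^ 8) ^ 2 := by ring
      _ ≤ 1 := pow_le_one₀ (by positivity) hL8
  have hHle : (H₁ : ℝ) ≤ 1 / t ^ 2 := by rw [le_div_iff₀ (by positivity)]; exact F1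
  have h2R : 2 * R ≤ H₁ := hHR
  have h2Rr : 2 * (R : ℝ) ≤ H₁ := by exact_mod_cast h2R
  have hH1r : (1 : ℝ) ≤ H₁ := by linarith
  have hH1 : 1 ≤ H₁ := by exact_mod_cast hH1r
  have hH0 : (0 : ℝ) < H₁ := by linarith
  have hRH : R ≤ H₁ := by omega
  have hHt3 : (H₁ : ℝ) ≤ 1 / t ^ 3 := by
    refine hHle.trans ?_
    rw [div_le_div_iff₀ (by positivity) ht3, one_mul, one_mul]
    calc t ^ 3 = t ^ 2 * t := by ring
      _ ≤ t ^ 2 * 1 := mul_le_mul_of_nonneg_left ht1 (by positivity)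
      _ = t ^ 2 := mul_one _
  have hHQr : (H₁ : ℝ) ≤ Q := hHt3.trans (by rw [one_div]; exact hQr1)
  have hHQ : H₁ ≤ Q := by exact_mod_cast hHQr
  have ht7L : 1 / t ^ 7 ≤ (L : ℝ) / 64 := by
    rw [div_le_div_iff₀ ht7 (by norm_num)]; linarith
  have hQLr : (Q : ℝ) ≤ L := by
    calc (Q : ℝ) ≤ 2 / t ^ 3 := hQle
      _ ≤ 2 / t ^ 7 := by
          apply div_le_div_of_nonneg_left (by norm_num) ht7
          exact pow_le_pow_of_le_one ht.le ht1 (by norm_num)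
      _ = 2 * (1 / t ^ 7) := by ring
      _ ≤ 2 * (L / 64) := by linarith
      _ ≤ L := by linarith
  have hQL : Q ≤ L := by exact_mod_cast hQLr
  -- Steps 2–3
  obtain ⟨θ, hθ, h23⟩ := step23 hD hb4 (lam := t ^ 13) (Λ := C₀ * t ^ 13) (by positivity)
    (le_mul_of_one_le_left (pow_pos ht 13).le hC₀)
    (N := Q) hH1 hQ1 hQL hR1 hRH hQ1
  refine h23.trans ?_
  clear h23
  have hCdiv : C₀ * t ^ 13 / t ^ 13 = C₀ := by field_simp
  simp only [hCdiv]
  rw [Finset.sum_add_distrib, Finset.sum_add_distrib]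
  -- notation
  set P : ℝ := 4 * (L : ℝ) * H₁ / (Q * R) with hP
  set RR := (Finset.Ioo (-(R : ℤ)) R).erase 0 with hRR
  set QQ := (Finset.Ioo (-(Q : ℤ)) Q).erase 0 with hQQ
  set HH := Finset.Ico (H₁ : ℤ) (2 * H₁) with hHH
  have hP0 : 0 ≤ P := by positivity
  have hPle : P ≤ 4 * L * t ^ 2 := by
    rw [hP, div_le_iff₀ (by positivity)]
    have h1 : (H₁ : ℝ) ≤ t ^ 2 * (Q * R) := by
      refine hHle.trans ?_
      rw [div_le_iff₀ (by positivity)]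
      calc (1 : ℝ) = 1 * 1 := by ring
        _ ≤ (Q * t ^ 3) * (R * t) := mul_le_mul hQt1 hRt1 zero_le_one (by positivity)
        _ = t ^ 2 * (Q * R) * t ^ 2 := by ring
    calc 4 * (L : ℝ) * H₁ ≤ 4 * L * (t ^ 2 * (Q * R)) := mul_le_mul_of_nonneg_left h1 (by positivity)
      _ = 4 * L * t ^ 2 * (Q * R) := by ring
  -- cardinalities
  have h0R : (0 : ℤ) ∈ Finset.Ioo (-(R : ℤ)) R := by rw [Finset.mem_Ioo]; omega
  have h0Q : (0 : ℤ) ∈ Finset.Ioo (-(Q : ℤ)) Q := by rw [Finset.mem_Ioo]; omega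
  have hcardR : (RR.card : ℝ) ≤ 4 / t := by
    have : (RR.card : ℝ) ≤ 2 * R := by
      rw [hRR, Finset.card_erase_of_mem h0R, Int.card_Ioo]
      have : ((R : ℤ) - -(R : ℤ) - 1).toNat - 1 ≤ 2 * R := by omega
      exact_mod_cast this
    refine this.trans ?_
    rw [le_div_iff₀ ht]; linarith only [hRt2]
  have hcardR' : (RR.card : ℝ) ≤ 2 * R := by
    rw [hRR, Finset.card_erase_of_mem h0R, Int.card_Ioo]
    have : ((R : ℤ) - -(R : ℤ) - 1).toNat - 1 ≤ 2 * R := by omega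
    exact_mod_cast this
  have hcardQ : (QQ.card : ℝ) ≤ 4 / t ^ 3 := by
    have : (QQ.card : ℝ) ≤ 2 * Q := by
      rw [hQQ, Finset.card_erase_of_mem h0Q, Int.card_Ioo]
      have : ((Q : ℤ) - -(Q : ℤ) - 1).toNat - 1 ≤ 2 * Q := by omega
      exact_mod_cast this
    refine this.trans ?_
    rw [le_div_iff₀ ht3]; linarith only [hQt2]
  have hcardH : (HH.card : ℝ) = H₁ := by
    rw [hHH, Int.card_Ico]
    have : (2 * (H₁ : ℤ) - H₁).toNat = H₁ := by rw [show 2 * (H₁ : ℤ) - H₁ = H₁ by ring]; simp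
    rw [this]
  have hmemQ : ∀ q ∈ QQ, q ≠ 0 ∧ -(Q : ℤ) < q ∧ q < Q := fun q hq => by
    rw [hQQ, Finset.mem_erase, Finset.mem_Ioo] at hq; exact ⟨hq.1, hq.2⟩
  have hmemR : ∀ r ∈ RR, r ≠ 0 ∧ -(R : ℤ) < r ∧ r < R := fun r hr => by
    rw [hRR, Finset.mem_erase, Finset.mem_Ioo] at hr; exact ⟨hr.1, hr.2⟩
  have hmemH : ∀ h ∈ HH, (H₁ : ℤ) ≤ h ∧ h < 2 * H₁ := fun h hh => by rwa [hHH, Finset.mem_Ico] at hh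
  ------------------------------------------------------------------
  -- (B1) `P · LH₁ ≤ 4L²`
  have hB1 : P * ((L : ℝ) * H₁) ≤ 4 * (L : ℝ) ^ 2 := by
    calc P * ((L : ℝ) * H₁) ≤ (4 * L * t ^ 2) * ((L : ℝ) * H₁) := mul_le_mul_of_nonneg_right hPle (by positivity)
      _ = 4 * L ^ 2 * (H₁ * t ^ 2) := by ring
      _ ≤ 4 * L ^ 2 * 1 := mul_le_mul_of_nonneg_left F1 (by positivity)
      _ = 4 * L ^ 2 := mul_one _
  ------------------------------------------------------------------
  -- (B2) the second-derivative terms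
  have hB2 : P * (∑ q ∈ QQ, ∑ h ∈ HH, 12 * (C₀ * L * Real.sqrt (2 * h * |(q : ℝ)| * t ^ 13) +
      1 / Real.sqrt (2 * h * |(q : ℝ)| * t ^ 13))) ≤ (576 * C₀ + 5) * (L : ℝ) ^ 2 := by
    -- per `q`: sum over `h`
    have hq : ∀ q ∈ QQ, ∑ h ∈ HH, 12 * (C₀ * L * Real.sqrt (2 * h * |(q : ℝ)| * t ^ 13) +
        1 / Real.sqrt (2 * h * |(q : ℝ)| * t ^ 13)) ≤
        36 * C₀ * L * t ^ 2 + 12 * (1 / (t * Real.sqrt (t ^ 13))) * (1 / Real.sqrt |(q : ℝ)|) := by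
      intro q hq
      obtain ⟨hq0, hq1, hq2⟩ := hmemQ q hq
      have hqabs : (0 : ℝ) < |(q : ℝ)| := by rw [abs_pos]; exact_mod_cast hq0
      have hqQ : |(q : ℝ)| ≤ Q := by
        rw [abs_le]; constructor
        · have : ((-(Q : ℤ) : ℤ) : ℝ) < q := by exact_mod_cast hq1
          push_cast at this; linarith
        · have : (q : ℝ) < ((Q : ℤ) : ℝ) := by exact_mod_cast hq2
          push_cast at this; linarith
      -- per `h`
      have hh : ∀ h ∈ HH, 12 * (C₀ * L * Real.sqrt (2 * h * |(q : ℝ)| * t ^ 13) +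
          1 / Real.sqrt (2 * h * |(q : ℝ)| * t ^ 13)) ≤
          36 * C₀ * L * t ^ 4 + 12 * (1 / Real.sqrt (2 * H₁ * |(q : ℝ)| * t ^ 13)) := by
        intro h hh
        obtain ⟨hh1, hh2⟩ := hmemH h hh
        have hhr1 : (H₁ : ℝ) ≤ h := by exact_mod_cast hh1
        have hhr2 : (h : ℝ) ≤ 2 * H₁ := by
          have : (h : ℝ) < ((2 * H₁ : ℤ) : ℝ) := by exact_mod_cast hh2
          push_cast at this; linarith
        have hs1 : Real.sqrt (2 * h * |(q : ℝ)| * t ^ 13) ≤ 3 * t ^ 4 := by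
          apply VdC.Num.sqrt_le_of_le_sq (by positivity)
          calc 2 * (h : ℝ) * |(q : ℝ)| * t ^ 13 ≤ 2 * (2 * H₁) * Q * t ^ 13 := by
                refine mul_le_mul_of_nonneg_right ?_ (by positivity)
                exact mul_le_mul (by linarith) hqQ hqabs.le (by positivity)
            _ = 4 * (H₁ * t ^ 2) * (Q * t ^ 3) * t ^ 8 := by ring
            _ ≤ 4 * 1 * 2 * t ^ 8 := by
                refine mul_le_mul_of_nonneg_right ?_ (by positivity)
                exact mul_le_mul (mul_le_mul_of_nonneg_left F1 (by norm_num)) hQt2 (by positivity) (by positivity)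
            _ ≤ (3 * t ^ 4) ^ 2 := by nlinarith only [pow_pos ht 8]
        have hs2 : 1 / Real.sqrt (2 * h * |(q : ℝ)| * t ^ 13) ≤ 1 / Real.sqrt (2 * H₁ * |(q : ℝ)| * t ^ 13) := by
          apply one_div_le_one_div_of_le (Real.sqrt_pos.mpr (by positivity))
          exact Real.sqrt_le_sqrt (by nlinarith only [hhr1, mul_pos hqabs (pow_pos ht 13)])
        have : 12 * (C₀ * L * Real.sqrt (2 * h * |(q : ℝ)| * t ^ 13)) ≤ 36 * C₀ * L * t ^ 4 := by
          calc 12 * (C₀ * L * Real.sqrt (2 * h * |(q : ℝ)| * t ^ 13)) ≤ 12 * (C₀ * L * (3 * t ^ 4)) := by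
                gcongr
            _ = 36 * C₀ * L * t ^ 4 := by ring
        linarith only [this, hs2]
      calc _ ≤ ∑ h ∈ HH, (36 * C₀ * L * t ^ 4 + 12 * (1 / Real.sqrt (2 * H₁ * |(q : ℝ)| * t ^ 13))) :=
            Finset.sum_le_sum hh
        _ = H₁ * (36 * C₀ * L * t ^ 4 + 12 * (1 / Real.sqrt (2 * H₁ * |(q : ℝ)| * t ^ 13))) := by
            rw [Finset.sum_const, nsmul_eq_mul, hcardH]
        _ = 36 * C₀ * L * t ^ 2 * (H₁ * t ^ 2) + 12 * ((H₁ : ℝ) / Real.sqrt (2 * H₁ * |(q : ℝ)| * t ^ 13)) := by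
            ring
        _ ≤ 36 * C₀ * L * t ^ 2 * 1 + 12 * ((1 / (t * Real.sqrt (t ^ 13))) * (1 / Real.sqrt |(q : ℝ)|)) := by
            refine add_le_add (mul_le_mul_of_nonneg_left F1 (by positivity)) (mul_le_mul_of_nonneg_left ?_ (by norm_num))
            -- `H₁/√(2H₁|q|t¹³) ≤ 1/(t √t¹³ √|q|)`
            have hsq : Real.sqrt (2 * H₁ * |(q : ℝ)| * t ^ 13) =
                Real.sqrt (2 * H₁) * Real.sqrt |(q : ℝ)| * Real.sqrt (t ^ 13) := by
              rw [← Real.sqrt_mul (by positivity), ← Real.sqrt_mul (by positivity)]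
            rw [hsq, div_le_iff₀ (by positivity), one_div, one_div]
            rw [show (t * Real.sqrt (t ^ 13))⁻¹ * (Real.sqrt |(q : ℝ)|)⁻¹ *
                (Real.sqrt (2 * H₁) * Real.sqrt |(q : ℝ)| * Real.sqrt (t ^ 13)) =
                Real.sqrt (2 * H₁) / t by field_simp]
            rw [le_div_iff₀ ht]
            -- `H₁ t ≤ √(2H₁)`
            have h1 : ((H₁ : ℝ) * t) ^ 2 ≤ 2 * H₁ := by nlinarith only [F1, hH0.le, hH0]
            calc (H₁ : ℝ) * t = Real.sqrt (((H₁ : ℝ) * t) ^ 2) := (Real.sqrt_sq (by positivity)).symm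
              _ ≤ Real.sqrt (2 * H₁) := Real.sqrt_le_sqrt h1
        _ = _ := by ring
    -- sum over `q`
    have hsumq : ∑ q ∈ QQ, ∑ h ∈ HH, 12 * (C₀ * L * Real.sqrt (2 * h * |(q : ℝ)| * t ^ 13) +
        1 / Real.sqrt (2 * h * |(q : ℝ)| * t ^ 13)) ≤
        (4 / t ^ 3) * (36 * C₀ * L * t ^ 2) + 12 * (1 / (t * Real.sqrt (t ^ 13))) * (4 * Real.sqrt Q) := by
      calc _ ≤ ∑ q ∈ QQ, (36 * C₀ * L * t ^ 2 + 12 * (1 / (t * Real.sqrt (t ^ 13))) * (1 / Real.sqrt |(q : ℝ)|)) :=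
            Finset.sum_le_sum hq
        _ = QQ.card * (36 * C₀ * L * t ^ 2) + 12 * (1 / (t * Real.sqrt (t ^ 13))) *
              ∑ q ∈ QQ, 1 / Real.sqrt |(q : ℝ)| := by
            rw [Finset.sum_add_distrib, Finset.sum_const, nsmul_eq_mul, Finset.mul_sum]
        _ ≤ (4 / t ^ 3) * (36 * C₀ * L * t ^ 2) + 12 * (1 / (t * Real.sqrt (t ^ 13))) * (4 * Real.sqrt Q) := by
            refine add_le_add (mul_le_mul_of_nonneg_right hcardQ (by positivity))
              (mul_le_mul_of_nonneg_left ?_ (by positivity))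
            rw [hQQ]; exact sum_inv_sqrt_abs_le Q
    -- the final numerics
    have hpart1 : P * ((4 / t ^ 3) * (36 * C₀ * L * t ^ 2)) ≤ 576 * C₀ * (L : ℝ) ^ 2 := by
      calc P * ((4 / t ^ 3) * (36 * C₀ * L * t ^ 2)) ≤ (4 * L * t ^ 2) * ((4 / t ^ 3) * (36 * C₀ * L * t ^ 2)) :=
            mul_le_mul_of_nonneg_right hPle (by positivity)
        _ = 576 * C₀ * L ^ 2 * t := by field_simp; ring
        _ ≤ 576 * C₀ * L ^ 2 * 1 := mul_le_mul_of_nonneg_left ht1 (by positivity)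
        _ = _ := mul_one _
    have hpart2 : P * (12 * (1 / (t * Real.sqrt (t ^ 13))) * (4 * Real.sqrt Q)) ≤ 5 * (L : ℝ) ^ 2 := by
      have hst : 0 < Real.sqrt (t ^ 13) := Real.sqrt_pos.mpr (pow_pos ht 13)
      calc P * (12 * (1 / (t * Real.sqrt (t ^ 13))) * (4 * Real.sqrt Q)) ≤
          (4 * L * t ^ 2) * (12 * (1 / (t * Real.sqrt (t ^ 13))) * (4 * Real.sqrt Q)) :=
            mul_le_mul_of_nonneg_right hPle (by positivity)
        _ = (192 * L * t * Real.sqrt Q) / Real.sqrt (t ^ 13) := by field_simp; ring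
        _ ≤ 5 * (L : ℝ) ^ 2 := by
            rw [div_le_iff₀ hst]
            -- compare squares
            have hA : 0 ≤ 192 * (L : ℝ) * t * Real.sqrt Q := by positivity
            have hB : 0 ≤ 5 * (L : ℝ) ^ 2 * Real.sqrt (t ^ 13) := by positivity
            rw [← pow_le_pow_iff_left₀ hA hB two_ne_zero]
            have eA : (192 * (L : ℝ) * t * Real.sqrt Q) ^ 2 = 192 ^ 2 * L ^ 2 * t ^ 2 * Q := by
              rw [mul_pow, Real.sq_sqrt hQ0.le]; ring
            have eB : (5 * (L : ℝ) ^ 2 * Real.sqrt (t ^ 13)) ^ 2 = 25 * L ^ 4 * t ^ 13 := by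
              rw [mul_pow, Real.sq_sqrt (pow_pos ht 13).le]; ring
            rw [eA, eB]
            -- `192² L² t² Q · t ≤ 2·192² L²` and `25 L⁴ t¹³ · t = 25 L² (Lt⁷)² ≥ 25·64² L²`
            have h1 : 192 ^ 2 * (L : ℝ) ^ 2 * t ^ 2 * Q * t ≤ 25 * (L : ℝ) ^ 4 * t ^ 13 * t := by
              calc 192 ^ 2 * (L : ℝ) ^ 2 * t ^ 2 * Q * t = 192 ^ 2 * (L : ℝ) ^ 2 * ((Q : ℝ) * t ^ 3) := by ring
                _ ≤ 192 ^ 2 * (L : ℝ) ^ 2 * 2 := mul_le_mul_of_nonneg_left hQt2 (by positivity)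
                _ ≤ 25 * (L : ℝ) ^ 2 * 64 ^ 2 := by nlinarith only [sq_nonneg (L : ℝ)]
                _ ≤ 25 * (L : ℝ) ^ 2 * ((L : ℝ) * t ^ 7) ^ 2 := by
                    refine mul_le_mul_of_nonneg_left ?_ (by positivity)
                    exact pow_le_pow_left₀ (by norm_num) hL 2
                _ = 25 * (L : ℝ) ^ 4 * t ^ 13 * t := by ring
            exact le_of_mul_le_mul_right h1 ht
    calc _ ≤ P * ((4 / t ^ 3) * (36 * C₀ * L * t ^ 2) + 12 * (1 / (t * Real.sqrt (t ^ 13))) * (4 * Real.sqrt Q)) :=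
          mul_le_mul_of_nonneg_left hsumq hP0
      _ = P * ((4 / t ^ 3) * (36 * C₀ * L * t ^ 2)) + P * (12 * (1 / (t * Real.sqrt (t ^ 13))) * (4 * Real.sqrt Q)) := by
          ring
      _ ≤ 576 * C₀ * (L : ℝ) ^ 2 + 5 * (L : ℝ) ^ 2 := add_le_add hpart1 hpart2
      _ = _ := by ring
  ------------------------------------------------------------------
  -- (B3) the third-derivative terms
  have hB3 : P * ∑ r ∈ RR, (H₁ : ℝ) * (96 * C₀ * (L * (2 * |(r : ℝ)| * t ^ 13) ^ (1 / 6 : ℝ) +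
      (L : ℝ) ^ (1 / 2 : ℝ) * (2 * |(r : ℝ)| * t ^ 13) ^ (-(1 / 6 : ℝ)))) ≤ 4608 * C₀ * (L : ℝ) ^ 2 := by
    have hr : ∀ r ∈ RR, (H₁ : ℝ) * (96 * C₀ * (L * (2 * |(r : ℝ)| * t ^ 13) ^ (1 / 6 : ℝ) +
        (L : ℝ) ^ (1 / 2 : ℝ) * (2 * |(r : ℝ)| * t ^ 13) ^ (-(1 / 6 : ℝ)))) ≤ H₁ * (96 * C₀ * (3 * L * t)) := by
      intro r hr
      obtain ⟨hr0, hr1, hr2⟩ := hmemR r hr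
      have hrabs : (0 : ℝ) < |(r : ℝ)| := by rw [abs_pos]; exact_mod_cast hr0
      have hrabs1 : (1 : ℝ) ≤ |(r : ℝ)| := by
        have : (1 : ℤ) ≤ |r| := Int.one_le_abs hr0
        have : ((1 : ℤ) : ℝ) ≤ ((|r| : ℤ) : ℝ) := by exact_mod_cast this
        simpa using this
      have hrR : |(r : ℝ)| ≤ R := by
        rw [abs_le]; constructor
        · have : ((-(R : ℤ) : ℤ) : ℝ) < r := by exact_mod_cast hr1
          push_cast at this; linarith
        · have : (r : ℝ) < ((R : ℤ) : ℝ) := by exact_mod_cast hr2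
          push_cast at this; linarith
      set y : ℝ := 2 * |(r : ℝ)| * t ^ 13 with hy
      have hy0 : 0 < y := by positivity
      -- `y^{1/6} ≤ 2t²`
      have h16 : y ^ (1 / 6 : ℝ) ≤ 2 * t ^ 2 := by
        apply rpow_sixth_le hy0.le (by positivity)
        calc y ≤ 2 * R * t ^ 13 := by rw [hy]; gcongr
          _ = 2 * (R * t) * t ^ 12 := by ring
          _ ≤ 2 * 2 * t ^ 12 := by gcongr
          _ ≤ (2 * t ^ 2) ^ 6 := by nlinarith only [pow_pos ht 12]
      -- `y^{-1/6} ≤ t √L / 8`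
      have hm16 : y ^ (-(1 / 6 : ℝ)) ≤ t * Real.sqrt L / 8 := by
        apply rpow_neg_sixth_le hy0 (by positivity)
        have eZ : (t * Real.sqrt L / 8) ^ 6 * y = t ^ 19 * (L : ℝ) ^ 3 * (2 * |(r : ℝ)|) / 8 ^ 6 := by
          have : Real.sqrt (L : ℝ) ^ 6 = (L : ℝ) ^ 3 := by
            rw [show (6 : ℕ) = 2 * 3 by norm_num, pow_mul, Real.sq_sqrt hL0.le]
          rw [hy, div_pow, mul_pow, this]; ring
        rw [eZ, le_div_iff₀ (by positivity), one_mul]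
        have h1 : (64 : ℝ) ^ 3 ≤ (L * t ^ 7) ^ 3 := pow_le_pow_left₀ (by norm_num) hL 3
        have h2 : (L * t ^ 7 : ℝ) ^ 3 = t ^ 19 * L ^ 3 * t ^ 2 := by ring
        have h3 : t ^ 19 * (L : ℝ) ^ 3 * t ^ 2 ≤ t ^ 19 * L ^ 3 * 1 :=
          mul_le_mul_of_nonneg_left (pow_le_one₀ ht.le ht1) (by positivity)
        have h4 : t ^ 19 * (L : ℝ) ^ 3 * 1 ≤ t ^ 19 * L ^ 3 * (2 * |(r : ℝ)|) :=
          mul_le_mul_of_nonneg_left (by linarith) (by positivity)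
        norm_num at h1 ⊢
        linarith only [h1, h2, h3, h4]
      have hsqrtL : (L : ℝ) ^ (1 / 2 : ℝ) = Real.sqrt L := (Real.sqrt_eq_rpow (L : ℝ)).symm
      have hbr : L * y ^ (1 / 6 : ℝ) + (L : ℝ) ^ (1 / 2 : ℝ) * y ^ (-(1 / 6 : ℝ)) ≤ 3 * L * t := by
        rw [hsqrtL]
        have i1 : (L : ℝ) * y ^ (1 / 6 : ℝ) ≤ L * (2 * t ^ 2) := mul_le_mul_of_nonneg_left h16 hL0.le
        have i2 : Real.sqrt L * y ^ (-(1 / 6 : ℝ)) ≤ Real.sqrt L * (t * Real.sqrt L / 8) :=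
          mul_le_mul_of_nonneg_left hm16 (Real.sqrt_nonneg _)
        have e2 : Real.sqrt L * (t * Real.sqrt L / 8) = t * L / 8 := by
          rw [show Real.sqrt L * (t * Real.sqrt L / 8) = t * (Real.sqrt (L : ℝ) * Real.sqrt L) / 8 by ring,
            Real.mul_self_sqrt hL0.le]
        have i3 : (L : ℝ) * (2 * t ^ 2) ≤ L * (2 * t) := by
          refine mul_le_mul_of_nonneg_left ?_ hL0.le; nlinarith only [ht.le, ht1]
        linarith only [i1, i2, e2, i3, mul_nonneg hL0.le ht.le]
      calc _ ≤ (H₁ : ℝ) * (96 * C₀ * (3 * L * t)) := by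
            refine mul_le_mul_of_nonneg_left (mul_le_mul_of_nonneg_left hbr (by positivity)) hH0.le
        _ = _ := rfl
    calc _ ≤ P * ∑ r ∈ RR, (H₁ : ℝ) * (96 * C₀ * (3 * L * t)) :=
          mul_le_mul_of_nonneg_left (Finset.sum_le_sum hr) hP0
      _ = P * (RR.card * ((H₁ : ℝ) * (96 * C₀ * (3 * L * t)))) := by rw [Finset.sum_const, nsmul_eq_mul]
      _ ≤ (4 * L * t ^ 2) * ((4 / t) * ((H₁ : ℝ) * (96 * C₀ * (3 * L * t)))) := by
          refine mul_le_mul hPle (mul_le_mul_of_nonneg_right hcardR (by positivity)) (by positivity) (by positivity)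
      _ = 4608 * C₀ * L ^ 2 * (H₁ * t ^ 2) := by field_simp; ring
      _ ≤ 4608 * C₀ * L ^ 2 * 1 := mul_le_mul_of_nonneg_left F1 (by positivity)
      _ = _ := mul_one _
  ------------------------------------------------------------------
  -- (B4) the errors of the shift
  have hY16 : 2 * ((Q : ℝ) + Q + 3 * H₁ + R + 7) + Q ≤ 34 / t ^ 3 := by
    have h7 : (7 : ℝ) ≤ 7 / t ^ 3 := by rw [le_div_iff₀ ht3]; linarith only [ht31]
    have hR3 : (R : ℝ) ≤ 2 / t ^ 3 := by
      refine hRle.trans ?_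
      apply div_le_div_of_nonneg_left (by norm_num) ht3
      calc t ^ 3 = t * t ^ 2 := by ring
        _ ≤ t * 1 := mul_le_mul_of_nonneg_left (pow_le_one₀ ht.le ht1) ht.le
        _ = t := mul_one _
    have hH3 : (H₁ : ℝ) ≤ 1 / t ^ 3 := hHt3
    have e : (34 : ℝ) / t ^ 3 = 2 * (2 / t ^ 3 + 2 / t ^ 3 + 3 * (1 / t ^ 3) + 2 / t ^ 3 + 7 / t ^ 3) + 2 / t ^ 3 := by
      ring
    rw [e]; linarith only [hQle, hR3, hH3, h7]
  have hB4 : P * ∑ r ∈ RR, 2 * (Q : ℝ) * H₁ * (2 * ((Q : ℝ) + Q + 3 * H₁ + R + 7) + Q) ≤ 34 * (L : ℝ) ^ 2 := by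
    rw [Finset.sum_const, nsmul_eq_mul]
    have h1 : 2 * (Q : ℝ) * H₁ ≤ 4 / t ^ 5 := by
      rw [le_div_iff₀ (pow_pos ht 5)]
      calc 2 * (Q : ℝ) * H₁ * t ^ 5 = 2 * (Q * t ^ 3) * (H₁ * t ^ 2) := by ring
        _ ≤ 2 * 2 * 1 := mul_le_mul (mul_le_mul_of_nonneg_left hQt2 (by norm_num)) F1 (by positivity) (by positivity)
        _ = 4 := by norm_num
    calc P * (RR.card * (2 * (Q : ℝ) * H₁ * (2 * ((Q : ℝ) + Q + 3 * H₁ + R + 7) + Q)))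
        ≤ (4 * L * t ^ 2) * ((4 / t) * ((4 / t ^ 5) * (34 / t ^ 3))) := by
          refine mul_le_mul hPle ?_ (by positivity) (by positivity)
          refine mul_le_mul hcardR (mul_le_mul h1 hY16 (by positivity) (by positivity)) (by positivity) (by positivity)
      _ = 2176 * L * (1 / t ^ 7) := by field_simp; ring
      _ ≤ 2176 * L * (L / 64) := mul_le_mul_of_nonneg_left ht7L (by positivity)
      _ = 34 * (L : ℝ) ^ 2 := by ring
  ------------------------------------------------------------------
  -- (B5) the main term
  set Y₀ : ℤ := (Q : ℤ) + Q + 3 * H₁ + R + 7 with hY₀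
  have hY₀r : ((Y₀ : ℤ) : ℝ) = (Q : ℝ) + Q + 3 * H₁ + R + 7 := by rw [hY₀]; push_cast; ring
  have hY₀le : ((Y₀ : ℤ) : ℝ) ≤ 16 / t ^ 3 := by
    rw [hY₀r]
    have h7 : (7 : ℝ) ≤ 7 / t ^ 3 := by rw [le_div_iff₀ ht3]; linarith only [ht31]
    have hR3 : (R : ℝ) ≤ 2 / t ^ 3 := by
      refine hRle.trans ?_
      apply div_le_div_of_nonneg_left (by norm_num) ht3
      calc t ^ 3 = t * t ^ 2 := by ring
        _ ≤ t * 1 := mul_le_mul_of_nonneg_left (pow_le_one₀ ht.le ht1) ht.le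
        _ = t := mul_one _
    have e : (16 : ℝ) / t ^ 3 = 2 / t ^ 3 + 2 / t ^ 3 + 3 * (1 / t ^ 3) + 2 / t ^ 3 + 7 / t ^ 3 := by ring
    rw [e]; linarith only [hQle, hR3, hHt3, h7]
  have hY₀0 : (0 : ℝ) ≤ ((Y₀ : ℤ) : ℝ) := by rw [hY₀r]; positivity
  -- `M`
  have hMnat : 2 * (Q + Q + 3 * H₁ + R + 7) + Q + 1 ≤ L := by
    have h1 : (2 * ((Q : ℝ) + Q + 3 * H₁ + R + 7) + Q) + 1 ≤ L := by
      have : (34 : ℝ) / t ^ 3 + 1 ≤ L := by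
        have h2 : (34 : ℝ) / t ^ 3 ≤ 34 / t ^ 7 := by
          apply div_le_div_of_nonneg_left (by norm_num) ht7
          exact pow_le_pow_of_le_one ht.le ht1 (by norm_num)
        have h3 : (34 : ℝ) / t ^ 7 + 1 ≤ 35 * (1 / t ^ 7) := by
          have : (1 : ℝ) ≤ 1 / t ^ 7 := by rw [le_div_iff₀ ht7]; linarith only [pow_le_one₀ ht.le ht1 (n := 7)]
          have e7 : (34 : ℝ) / t ^ 7 = 34 * (1 / t ^ 7) := by ring
          linarith only [this, e7]
        linarith only [h2, h3, ht7L, hL0.le]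
      linarith only [this, hY16]
    exact_mod_cast h1
  set M : ℕ := L - (2 * (Q + Q + 3 * H₁ + R + 7) + Q) with hMdef
  have hM1 : 1 ≤ M := by omega
  have hMz : (M : ℤ) = (L : ℤ) - 2 * Y₀ - Q := by
    rw [hMdef, hY₀]; push_cast [Nat.cast_sub (by omega : 2 * (Q + Q + 3 * H₁ + R + 7) + Q ≤ L)]; ring
  have hMr : (M : ℝ) = (L : ℝ) - 2 * ((Q : ℝ) + Q + 3 * H₁ + R + 7) - Q := by
    have : ((M : ℤ) : ℝ) = (((L : ℤ) - 2 * Y₀ - Q : ℤ) : ℝ) := by rw [hMz]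
    push_cast at this; rw [hY₀r] at this
    have e : ((M : ℤ) : ℝ) = (M : ℝ) := by simp
    linarith only [this, e]
  have hMle : (M : ℝ) ≤ L := by rw [hMr]; linarith only [hH0.le, hQ0.le, hR0.le]
  have hM4 : (L : ℝ) ≤ 4 * M := by
    rw [hMr]
    have : 2 * ((Q : ℝ) + Q + 3 * H₁ + R + 7) + Q ≤ 34 * (L / 64) := by
      calc _ ≤ 34 / t ^ 3 := hY16
        _ ≤ 34 / t ^ 7 := by
            apply div_le_div_of_nonneg_left (by norm_num) ht7
            exact pow_le_pow_of_le_one ht.le ht1 (by norm_num)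
        _ = 34 * (1 / t ^ 7) := by ring
        _ ≤ 34 * (L / 64) := by linarith only [ht7L]
    linarith only [this]
  -- `D_u ≤ Du₀`
  have hDu : 1 + 7 * (4 * (C₀ * t ^ 13) * ((Y₀ : ℤ) : ℝ) ^ 4) + 200 * (4 * (C₀ * t ^ 13) * ((Y₀ : ℤ) : ℝ) ^ 4) ^ 2 +
      250 * (4 * (C₀ * t ^ 13) * ((Y₀ : ℤ) : ℝ) ^ 4) ^ 3 ≤ Du₀ := by
    have hK : 4 * (C₀ * t ^ 13) * ((Y₀ : ℤ) : ℝ) ^ 4 ≤ K₀ := by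
      calc 4 * (C₀ * t ^ 13) * ((Y₀ : ℤ) : ℝ) ^ 4 ≤ 4 * (C₀ * t ^ 13) * (16 / t ^ 3) ^ 4 := by
            refine mul_le_mul_of_nonneg_left (pow_le_pow_left₀ hY₀0 hY₀le 4) (by positivity)
        _ = 262144 * C₀ * t := by field_simp; ring
        _ ≤ 262144 * C₀ * 1 := mul_le_mul_of_nonneg_left ht1 (by positivity)
        _ = K₀ := by rw [hK₀]; ring
    have hK0 : 0 ≤ 4 * (C₀ * t ^ 13) * ((Y₀ : ℤ) : ℝ) ^ 4 := by positivity
    rw [hDu₀]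
    have h2 := pow_le_pow_left₀ hK0 hK 2
    have h3 := pow_le_pow_left₀ hK0 hK 3
    linarith only [hK, h2, h3, hK0]
  have hDu0 : 0 ≤ 1 + 7 * (4 * (C₀ * t ^ 13) * ((Y₀ : ℤ) : ℝ) ^ 4) + 200 * (4 * (C₀ * t ^ 13) * ((Y₀ : ℤ) : ℝ) ^ 4) ^ 2 +
      250 * (4 * (C₀ * t ^ 13) * ((Y₀ : ℤ) : ℝ) ^ 4) ^ 3 := by positivity
  -- the main term bound
  have hmain := hC₇ D L (t ^ 13) (C₀ * t ^ 13) hD hb4 (by positivity)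
    (le_mul_of_one_le_left (pow_pos ht 13).le hC₀) R Q Q H₁ hR1 hQ1 h2R le_rfl
    hHQ Y₀ hY₀ M hM1 hMz θ hθ
  simp only [hCdiv] at hmain
  -- the numerics of the square root
  set Kr : ℝ := (⌊(2 * (13 * (H₁ : ℝ) * (Q : ℝ) ^ 2))⁻¹ / t ^ 13⌋₊ : ℝ) with hKr
  have hKr0 : 0 ≤ Kr := by rw [hKr]; positivity
  have hKrle : Kr ≤ 1 / (26 * H₁ * (Q : ℝ) ^ 2 * t ^ 13) := by
    rw [hKr]
    refine (Nat.floor_le (by positivity)).trans (le_of_eq ?_)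
    field_simp; ring
  have hKrL : Kr ≤ L := by
    refine hKrle.trans ?_
    rw [div_le_iff₀ (by positivity)]
    -- `1 ≤ L · 26 H₁ Q² t¹³` since `Q² t⁶ ≥ 1`, `L t⁷ ≥ 64`
    have h1 : (1 : ℝ) ≤ (Q * t ^ 3) ^ 2 := one_le_pow₀ hQt1
    calc (1 : ℝ) ≤ 64 * 1 * 1 := by norm_num
      _ ≤ (L * t ^ 7) * (Q * t ^ 3) ^ 2 * (26 * H₁) :=
          mul_le_mul (mul_le_mul hL h1 zero_le_one (by positivity)) (by linarith) zero_le_one (by positivity)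
      _ = L * (26 * H₁ * (Q : ℝ) ^ 2 * t ^ 13) := by ring
  have hlg : (Nat.log 2 Q : ℝ) + 1 ≤ (2 / ε + 1) * (L : ℝ) ^ ε := natLog_succ_le_rpow hε hQ1 hQLr
  have hlK : 1 + Real.log (⌊(2 * (13 * (H₁ : ℝ) * (Q : ℝ) ^ 2))⁻¹ / t ^ 13⌋₊ : ℕ) ≤ (1 / ε + 1) * (L : ℝ) ^ ε :=
    one_add_log_le_rpow hε hL1 hKrL
  have hlK0 : 0 ≤ Real.log (⌊(2 * (13 * (H₁ : ℝ) * (Q : ℝ) ^ 2))⁻¹ / t ^ 13⌋₊ : ℕ) := Real.log_natCast_nonneg _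
  have harg := arg_numeric (C₀ := C₀) (C₇ := C₇) (ε := ε) (t := t) (L := L) (H := H₁) (R := R) (Q := Q)
    (N := Q) (M := M) (cR := RR.card) (lg := (Nat.log 2 Q : ℝ) + 1) (Kr := Kr)
    (lK := Real.log (⌊(2 * (13 * (H₁ : ℝ) * (Q : ℝ) ^ 2))⁻¹ / t ^ 13⌋₊ : ℕ))
    hC₀ hC₇0 hε ht ht1 hL hL8 hH1r hH2 hRt1 hRt2 hQt1 hQt2 hQt1 hQt2 hM4 hMle (by positivity) hcardR'
    (by positivity) hlg hKr0 hKrle hlK0 hlK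
  -- abbreviate the argument of the square root
  set ARG : ℝ := 624 ^ 2 * ((Nat.log 2 Q : ℝ) + 1) ^ 2 * RR.card *
      ((1 + 3 * (Q : ℝ) * H₁) * (1 + C₀ * t ^ 13 * M * (13 * (H₁ : ℝ) * (Q : ℝ) ^ 2))) *
      (C₇ * (((R : ℝ) * Q * H₁ * Q) ^ (1 + ε) +
        ((R : ℝ) * Q * H₁ * Q) ^ ε * (R * Q * (1 / (C₀ * t ^ 13 * M) + 4 * R * (H₁ : ℝ) ^ 2)))) *
      (M + 2 * (2 * C₀ * M * (2 * (3 * (Q : ℝ) * H₁))⁻¹ * Kr + 2 * C₀ * t ^ 13 * M * Kr ^ 2 +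
        (2 * (2 * (3 * (Q : ℝ) * H₁))⁻¹ + 1) * ((2 * (3 * (Q : ℝ) * H₁))⁻¹ / t ^ 13) *
          (1 + Real.log (⌊(2 * (13 * (H₁ : ℝ) * (Q : ℝ) ^ 2))⁻¹ / t ^ 13⌋₊ : ℕ)) +
        (2 * (2 * (3 * (Q : ℝ) * H₁))⁻¹ + 1) * Kr)) with hARG
  have hARG0 : 0 ≤ ARG := by rw [hARG]; positivity
  have hB5 : P * ∑ r ∈ RR, (1 / (Q : ℝ) * ∑ m ∈ Finset.Ioc Y₀ ((L : ℤ) - Y₀ - Q),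
      ‖∑ q ∈ QQ, ∑ h ∈ HH, ∑ n ∈ Finset.Icc (1 : ℤ) Q,
        (((1 - |(q : ℝ)| / Q : ℝ)) : ℂ) * θ r h *
          e (D 0 ((m : ℝ) + n + q + h) - D 0 ((m : ℝ) + n + q - h) -
            (D 0 ((m : ℝ) + n + h + r) - D 0 ((m : ℝ) + n - h - r)))‖) ≤
      16 * Du₀ * Real.sqrt CONST * (L : ℝ) ^ (2 + 3 * ε) := by
    have hm : ∑ r ∈ RR, (1 / (Q : ℝ) * ∑ m ∈ Finset.Ioc Y₀ ((L : ℤ) - Y₀ - Q),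
        ‖∑ q ∈ QQ, ∑ h ∈ HH, ∑ n ∈ Finset.Icc (1 : ℤ) Q,
          (((1 - |(q : ℝ)| / Q : ℝ)) : ℂ) * θ r h *
            e (D 0 ((m : ℝ) + n + q + h) - D 0 ((m : ℝ) + n + q - h) -
              (D 0 ((m : ℝ) + n + h + r) - D 0 ((m : ℝ) + n - h - r)))‖) ≤
        1 / (Q : ℝ) * (16 * (1 + 7 * (4 * (C₀ * t ^ 13) * ((Y₀ : ℤ) : ℝ) ^ 4) +
          200 * (4 * (C₀ * t ^ 13) * ((Y₀ : ℤ) : ℝ) ^ 4) ^ 2 +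
          250 * (4 * (C₀ * t ^ 13) * ((Y₀ : ℤ) : ℝ) ^ 4) ^ 3) * Real.sqrt ARG) := by
      rw [hARG, hKr, hRR, hQQ, hHH]; exact hmain
    calc _ ≤ P * (1 / (Q : ℝ) * (16 * (1 + 7 * (4 * (C₀ * t ^ 13) * ((Y₀ : ℤ) : ℝ) ^ 4) +
          200 * (4 * (C₀ * t ^ 13) * ((Y₀ : ℤ) : ℝ) ^ 4) ^ 2 +
          250 * (4 * (C₀ * t ^ 13) * ((Y₀ : ℤ) : ℝ) ^ 4) ^ 3) * Real.sqrt ARG)) :=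
          mul_le_mul_of_nonneg_left hm hP0
      _ = 16 * (1 + 7 * (4 * (C₀ * t ^ 13) * ((Y₀ : ℤ) : ℝ) ^ 4) +
          200 * (4 * (C₀ * t ^ 13) * ((Y₀ : ℤ) : ℝ) ^ 4) ^ 2 +
          250 * (4 * (C₀ * t ^ 13) * ((Y₀ : ℤ) : ℝ) ^ 4) ^ 3) * ((P / Q) * Real.sqrt ARG) := by ring
      _ ≤ 16 * Du₀ * ((P / Q) * Real.sqrt ARG) := by
          refine mul_le_mul_of_nonneg_right (mul_le_mul_of_nonneg_left hDu (by norm_num)) (by positivity)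
      _ = 16 * Du₀ * Real.sqrt ((P / Q) ^ 2 * ARG) := by
          rw [Real.sqrt_mul (sq_nonneg (P / Q)) ARG, Real.sqrt_sq (by positivity)]
      _ ≤ 16 * Du₀ * Real.sqrt (CONST * (L : ℝ) ^ (4 + 5 * ε)) := by
          refine mul_le_mul_of_nonneg_left (Real.sqrt_le_sqrt ?_) (by positivity)
          have eP : P / Q = 4 * (L : ℝ) * H₁ / (Q * R * Q) := by rw [hP]; field_simp
          rw [eP, hARG, hCONST]
          exact harg
      _ = 16 * Du₀ * (Real.sqrt CONST * (L : ℝ) ^ ((4 + 5 * ε) / 2)) := by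
          rw [Real.sqrt_mul hCONST0.le, Real.sqrt_eq_rpow ((L : ℝ) ^ (4 + 5 * ε)), ← Real.rpow_mul hL0.le,
            show ((4 : ℝ) + 5 * ε) * (1 / 2) = (4 + 5 * ε) / 2 by ring]
      _ ≤ 16 * Du₀ * (Real.sqrt CONST * (L : ℝ) ^ (2 + 3 * ε)) := by
          refine mul_le_mul_of_nonneg_left (mul_le_mul_of_nonneg_left ?_ (Real.sqrt_nonneg _)) (by positivity)
          exact Real.rpow_le_rpow_of_exponent_le hL1 (by linarith only [hε])
      _ = _ := by ring
  clear hmain harg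
  ------------------------------------------------------------------
  -- assembling
  have hL2 : (L : ℝ) ^ 2 ≤ (L : ℝ) ^ (2 + 3 * ε) := by
    calc (L : ℝ) ^ 2 = (L : ℝ) ^ (2 : ℝ) := by norm_cast
      _ ≤ (L : ℝ) ^ (2 + 3 * ε) := Real.rpow_le_rpow_of_exponent_le hL1 (by linarith only [hε])
  have hc0 : 0 ≤ (43 + 5184 * C₀ : ℝ) := by positivity
  have h2 := mul_le_mul_of_nonneg_left hL2 hc0
  have hsplitP : ∀ a b c d e' : ℝ, P * (a + b + (c + d + e')) = P * a + P * b + P * c + P * d + P * e' := by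
    intros; ring
  rw [hsplitP]
  linarith only [hB1, hB2, hB3, hB4, hB5, h2]

/-! ### Step 0: all sizes of `M` -/

/-- Trivial bound: `‖∑_{0<n≤L} e(θ_n)‖ ≤ L`. [folklore] -/
theorem norm_sum_e_le_card (θ : ℤ → ℝ) (L : ℕ) : ‖∑ n ∈ Finset.Ioc (0 : ℤ) L, e (θ n)‖ ≤ L := by
  calc ‖∑ n ∈ Finset.Ioc (0 : ℤ) L, e (θ n)‖ ≤ ∑ n ∈ Finset.Ioc (0 : ℤ) L, ‖e (θ n)‖ := norm_sum_le _ _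
    _ = ∑ n ∈ Finset.Ioc (0 : ℤ) L, (1 : ℝ) := Finset.sum_congr rfl fun n _ => norm_e _
    _ = L := by rw [Finset.sum_const, Int.card_Ioc, nsmul_eq_mul, mul_one]; simp

set_option maxHeartbeats 4000000 in
/-- **Theorem 1 of [RS] for `M ≤ λ^{-8/13}`** (in the variables `t = λ^{1/13}`, `L = M`):
`|∑_{0<n≤L} e(f(n))| ≤ C(ε, C₀) (L+1)^{2ε} t⁻⁷` for `L t⁸ ≤ 1` — trivially if `L < 64t⁻⁷` ("if
`M ≪ λ^{-7/13}` the bound (1·6) is trivial"), and otherwise by Step 1 (`step1`, `H = ⌊L²t¹⁴⌋`),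
`small_block_bound` (`H₁ < 2R`) and `large_block_bound` (`H₁ ≥ 2R`). This replaces the printed
reduction to `M ≍ λ^{-8/13}` by the completion lemma (Huxley, Lemma 5.2.3): the whole chain is run
for `λ^{-7/13} ≪ M ≪ λ^{-8/13}` with `H ≍ M²λ^{14/13}`. [cite: RobertSargos2002, §4, Steps 0–1] -/
theorem short_bound (C₀ : ℝ) (hC₀ : 1 ≤ C₀) {ε : ℝ} (hε : 0 < ε) : ∃ C : ℝ, 0 < C ∧
    ∀ (t : ℝ), 0 < t → t ≤ 1 → ∀ (L : ℕ), (L : ℝ) * t ^ 8 ≤ 1 →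
    ∀ (D : ℕ → ℝ → ℝ), DerivFamily D 0 L 4 →
      (∀ x ∈ Set.Icc (0 : ℝ) L, t ^ 13 ≤ D 4 x ∧ D 4 x ≤ C₀ * t ^ 13) →
      ‖∑ n ∈ Finset.Ioc (0 : ℤ) L, e (D 0 n)‖ ≤ C * ((L : ℝ) + 1) ^ (2 * ε) / t ^ 7 := by
  obtain ⟨CL, hCL0, hCL⟩ := large_block_bound C₀ hC₀ hε
  set A : ℝ := 1152 * C₀ + Real.sqrt CL with hA
  set C' : ℝ := 6 + 12 * (2 / ε + 1) * A with hC'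
  have hC₀0 : 0 < C₀ := by linarith
  have hA0 : 0 < A := by rw [hA]; positivity
  have hC'0 : 0 < C' := by rw [hC']; positivity
  refine ⟨64 + Real.sqrt C', by positivity, ?_⟩
  intro t ht ht1 L hL8 D hD hb4
  have ht7 : 0 < t ^ 7 := pow_pos ht 7
  have hLp1 : (1 : ℝ) ≤ ((L : ℝ) + 1) ^ (2 * ε) := Real.one_le_rpow (by linarith [(Nat.cast_nonneg L : (0:ℝ) ≤ L)]) (by linarith)
  by_cases hsmall : (L : ℝ) * t ^ 7 < 64
  · -- trivial bound
    calc ‖∑ n ∈ Finset.Ioc (0 : ℤ) L, e (D 0 n)‖ ≤ L := norm_sum_e_le_card (fun n => D 0 n) L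
      _ ≤ 64 / t ^ 7 := by rw [le_div_iff₀ ht7]; exact hsmall.le
      _ = 64 * 1 / t ^ 7 := by ring
      _ ≤ (64 + Real.sqrt C') * ((L : ℝ) + 1) ^ (2 * ε) / t ^ 7 := by
          refine div_le_div_of_nonneg_right ?_ ht7.le
          exact mul_le_mul (by linarith [Real.sqrt_nonneg C']) hLp1 zero_le_one (by positivity)
  have hL : (64 : ℝ) ≤ L * t ^ 7 := not_lt.mp hsmall
  -- basic sizes
  have hL64 : (64 : ℝ) ≤ L := by
    have : (L : ℝ) * t ^ 7 ≤ L * 1 := mul_le_mul_of_nonneg_left (pow_le_one₀ ht.le ht1) (by positivity)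
    linarith
  have hL1 : (1 : ℝ) ≤ L := by linarith
  have hL0 : (0 : ℝ) < L := by linarith
  -- `H = ⌊L² t¹⁴⌋`
  set x : ℝ := (L : ℝ) ^ 2 * t ^ 14 with hx
  have hx64 : 4096 ≤ x := by
    calc (4096 : ℝ) = 64 ^ 2 := by norm_num
      _ ≤ ((L : ℝ) * t ^ 7) ^ 2 := pow_le_pow_left₀ (by norm_num) hL 2
      _ = x := by rw [hx]; ring
  have hxL : x ≤ L := by
    calc x = (L : ℝ) * ((L : ℝ) * t ^ 8) * t ^ 6 := by rw [hx]; ring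
      _ ≤ (L : ℝ) * 1 * 1 := by
          refine mul_le_mul (mul_le_mul_of_nonneg_left hL8 hL0.le) (pow_le_one₀ ht.le ht1) (by positivity)
            (by positivity)
      _ = L := by ring
  set H : ℕ := ⌊x⌋₊ with hHdef
  have hHx : (H : ℝ) ≤ x := Nat.floor_le (by positivity)
  have hHx' : x < (H : ℝ) + 1 := Nat.lt_floor_add_one x
  have hH2r : (2 : ℝ) ≤ H := by linarith
  have hH2 : 2 ≤ H := by exact_mod_cast hH2r
  have hHLr : (H : ℝ) ≤ L := hHx.trans hxL
  have hHL : H ≤ L := by exact_mod_cast hHLr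
  have hH0 : (0 : ℝ) < H := by linarith
  have hHinv : 1 / (H : ℝ) ≤ 2 / x := by
    rw [div_le_div_iff₀ hH0 (by linarith), one_mul]; linarith
  -- Step 1
  obtain ⟨H₁, hH₁1, hH₁H, hS1⟩ := step1 (D 0) hH2 hHL
  have hH₁x : (H₁ : ℝ) ≤ (L : ℝ) ^ 2 * t ^ 14 := by
    have : (H₁ : ℝ) ≤ H := by exact_mod_cast hH₁H.le
    exact this.trans hHx
  -- the dyadic piece
  set S₁ : ℝ := ∑ h ∈ Finset.Ico (H₁ : ℤ) (2 * H₁),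
      ‖∑ n ∈ Finset.Ioc h ((L : ℤ) - h), e (D 0 ((n : ℝ) + h) - D 0 ((n : ℝ) - h))‖ with hS₁
  have hS₁0 : 0 ≤ S₁ := Finset.sum_nonneg fun _ _ => norm_nonneg _
  have hLpow : (L : ℝ) ≤ (L : ℝ) ^ (1 + 2 * ε) := by
    calc (L : ℝ) = (L : ℝ) ^ (1 : ℝ) := (Real.rpow_one _).symm
      _ ≤ (L : ℝ) ^ (1 + 2 * ε) := Real.rpow_le_rpow_of_exponent_le hL1 (by linarith)
  have hS₁le : S₁ ≤ A * (L : ℝ) ^ (1 + 2 * ε) := by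
    by_cases hsm : H₁ < 2 * ⌈t⁻¹⌉₊
    · -- small `H₁`: third derivative test
      have hsb := small_block_bound hD hb4 (lam := t ^ 13) (Λ := C₀ * t ^ 13) (by positivity)
        (le_mul_of_one_le_left (pow_pos ht 13).le hC₀) hH₁1
      have hCdiv : C₀ * t ^ 13 / t ^ 13 = C₀ := by field_simp
      rw [hCdiv] at hsb
      -- numerics: `H₁ ≤ 4/t`, `(4H₁t¹³)^{1/6} ≤ 2t²`, `(2H₁t¹³)^{-1/6} ≤ t√L/8`
      have hR : (⌈t⁻¹⌉₊ : ℝ) < t⁻¹ + 1 := Nat.ceil_lt_add_one (by positivity)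
      have hH₁4 : (H₁ : ℝ) * t ≤ 4 := by
        have h1 : (H₁ : ℝ) ≤ 2 * ⌈t⁻¹⌉₊ := by exact_mod_cast hsm.le
        have h2 : (H₁ : ℝ) * t ≤ 2 * (t⁻¹ + 1) * t := by
          exact mul_le_mul_of_nonneg_right (by linarith) ht.le
        rw [show 2 * (t⁻¹ + 1) * t = 2 + 2 * t by field_simp] at h2
        linarith
      have hH₁0 : (0 : ℝ) < H₁ := by exact_mod_cast hH₁1
      have h16 : (4 * (H₁ : ℝ) * t ^ 13) ^ (1 / 6 : ℝ) ≤ 2 * t ^ 2 := by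
        apply rpow_sixth_le (by positivity) (by positivity)
        calc 4 * (H₁ : ℝ) * t ^ 13 = 4 * (H₁ * t) * t ^ 12 := by ring
          _ ≤ 4 * 4 * t ^ 12 := by
              refine mul_le_mul_of_nonneg_right (mul_le_mul_of_nonneg_left hH₁4 (by norm_num)) (by positivity)
          _ ≤ (2 * t ^ 2) ^ 6 := by nlinarith only [pow_pos ht 12]
      have hm16 : (2 * (H₁ : ℝ) * t ^ 13) ^ (-(1 / 6 : ℝ)) ≤ t * Real.sqrt L / 8 := by
        apply rpow_neg_sixth_le (by positivity) (by positivity)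
        have eZ : (t * Real.sqrt L / 8) ^ 6 * (2 * (H₁ : ℝ) * t ^ 13) =
            t ^ 19 * (L : ℝ) ^ 3 * (2 * H₁) / 8 ^ 6 := by
          have : Real.sqrt (L : ℝ) ^ 6 = (L : ℝ) ^ 3 := by
            rw [show (6 : ℕ) = 2 * 3 by norm_num, pow_mul, Real.sq_sqrt hL0.le]
          rw [div_pow, mul_pow, this]; ring
        rw [eZ, le_div_iff₀ (by positivity), one_mul]
        have h1 : (64 : ℝ) ^ 3 ≤ ((L : ℝ) * t ^ 7) ^ 3 := pow_le_pow_left₀ (by norm_num) hL 3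
        have h2 : ((L : ℝ) * t ^ 7) ^ 3 = t ^ 19 * (L : ℝ) ^ 3 * t ^ 2 := by ring
        have h3 : t ^ 19 * (L : ℝ) ^ 3 * t ^ 2 ≤ t ^ 19 * (L : ℝ) ^ 3 * 1 :=
          mul_le_mul_of_nonneg_left (pow_le_one₀ ht.le ht1) (by positivity)
        have hH₁1r : (1 : ℝ) ≤ H₁ := by exact_mod_cast hH₁1
        have h4 : t ^ 19 * (L : ℝ) ^ 3 * 1 ≤ t ^ 19 * (L : ℝ) ^ 3 * (2 * H₁) :=
          mul_le_mul_of_nonneg_left (by linarith) (by positivity)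
        norm_num at h1 ⊢
        linarith only [h1, h2, h3, h4]
      have hsqrtL : (L : ℝ) ^ (1 / 2 : ℝ) = Real.sqrt L := (Real.sqrt_eq_rpow (L : ℝ)).symm
      have hbr : (L : ℝ) * (4 * (H₁ : ℝ) * t ^ 13) ^ (1 / 6 : ℝ) +
          (L : ℝ) ^ (1 / 2 : ℝ) * (2 * (H₁ : ℝ) * t ^ 13) ^ (-(1 / 6 : ℝ)) ≤ 3 * L * t := by
        rw [hsqrtL]
        have i1 : (L : ℝ) * (4 * (H₁ : ℝ) * t ^ 13) ^ (1 / 6 : ℝ) ≤ L * (2 * t ^ 2) :=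
          mul_le_mul_of_nonneg_left h16 hL0.le
        have i2 : Real.sqrt L * (2 * (H₁ : ℝ) * t ^ 13) ^ (-(1 / 6 : ℝ)) ≤ Real.sqrt L * (t * Real.sqrt L / 8) :=
          mul_le_mul_of_nonneg_left hm16 (Real.sqrt_nonneg _)
        have e2 : Real.sqrt L * (t * Real.sqrt L / 8) = t * L / 8 := by
          rw [show Real.sqrt L * (t * Real.sqrt L / 8) = t * (Real.sqrt (L : ℝ) * Real.sqrt L) / 8 by ring,
            Real.mul_self_sqrt hL0.le]
        have i3 : (L : ℝ) * (2 * t ^ 2) ≤ L * (2 * t) := by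
          refine mul_le_mul_of_nonneg_left ?_ hL0.le; nlinarith only [ht.le, ht1]
        linarith only [i1, i2, e2, i3, mul_nonneg hL0.le ht.le]
      calc S₁ ≤ (H₁ : ℝ) * (96 * C₀ * ((L : ℝ) * (4 * (H₁ : ℝ) * t ^ 13) ^ (1 / 6 : ℝ) +
            (L : ℝ) ^ (1 / 2 : ℝ) * (2 * (H₁ : ℝ) * t ^ 13) ^ (-(1 / 6 : ℝ)))) := by rw [hS₁]; exact hsb
        _ ≤ (H₁ : ℝ) * (96 * C₀ * (3 * L * t)) := by
            refine mul_le_mul_of_nonneg_left (mul_le_mul_of_nonneg_left hbr (by positivity)) hH₁0.le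
        _ = 288 * C₀ * L * (H₁ * t) := by ring
        _ ≤ 288 * C₀ * L * 4 := mul_le_mul_of_nonneg_left hH₁4 (by positivity)
        _ = 1152 * C₀ * L := by ring
        _ ≤ A * L := by
            refine mul_le_mul_of_nonneg_right ?_ hL0.le
            rw [hA]; linarith [Real.sqrt_nonneg CL]
        _ ≤ A * (L : ℝ) ^ (1 + 2 * ε) := mul_le_mul_of_nonneg_left hLpow hA0.le
    · -- large `H₁`
      have hlb := hCL t ht ht1 L hL hL8 D hD hb4 H₁ hH₁x (not_lt.mp hsm)
      have h1 : S₁ ≤ Real.sqrt CL * (L : ℝ) ^ (1 + 3 / 2 * ε) := by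
        calc S₁ = Real.sqrt (S₁ ^ 2) := (Real.sqrt_sq hS₁0).symm
          _ ≤ Real.sqrt (CL * (L : ℝ) ^ (2 + 3 * ε)) := Real.sqrt_le_sqrt (by rw [hS₁]; exact hlb)
          _ = Real.sqrt CL * (L : ℝ) ^ (1 + 3 / 2 * ε) := by
              rw [Real.sqrt_mul hCL0.le, Real.sqrt_eq_rpow ((L : ℝ) ^ (2 + 3 * ε)), ← Real.rpow_mul hL0.le]
              congr 2; ring
      have h2 : (L : ℝ) ^ (1 + 3 / 2 * ε) ≤ (L : ℝ) ^ (1 + 2 * ε) :=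
        Real.rpow_le_rpow_of_exponent_le hL1 (by linarith)
      calc S₁ ≤ Real.sqrt CL * (L : ℝ) ^ (1 + 3 / 2 * ε) := h1
        _ ≤ Real.sqrt CL * (L : ℝ) ^ (1 + 2 * ε) := mul_le_mul_of_nonneg_left h2 (Real.sqrt_nonneg _)
        _ ≤ A * (L : ℝ) ^ (1 + 2 * ε) := by
            refine mul_le_mul_of_nonneg_right ?_ (by positivity)
            rw [hA]; linarith
  -- the logarithm
  have hlog : (Nat.log 2 (H - 1) : ℝ) + 1 ≤ (2 / ε + 1) * (L : ℝ) ^ ε := by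
    refine natLog_succ_le_rpow hε (by omega) ?_
    have : ((H - 1 : ℕ) : ℝ) ≤ H := by exact_mod_cast Nat.sub_le H 1
    exact this.trans hHLr
  -- combine: `S² ≤ 6/t¹⁴ + (12/(L t¹⁴)) (2/ε+1) L^ε A L^{1+2ε}`
  have hpow3 : (L : ℝ) ^ ε * (L : ℝ) ^ (1 + 2 * ε) = L * (L : ℝ) ^ (3 * ε) := by
    rw [← Real.rpow_add hL0, show ε + (1 + 2 * ε) = 1 + 3 * ε by ring, Real.rpow_add hL0, Real.rpow_one]
  have hL3ε : (1 : ℝ) ≤ (L : ℝ) ^ (3 * ε) := Real.one_le_rpow hL1 (by linarith)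
  have hS2 : ‖∑ n ∈ Finset.Ioc (0 : ℤ) L, e (D 0 n)‖ ^ 2 ≤ C' * (L : ℝ) ^ (3 * ε) / t ^ 14 := by
    have hx0 : 0 < x := by linarith
    have i1 : 3 * (L : ℝ) ^ 2 / H ≤ 6 / t ^ 14 := by
      calc 3 * (L : ℝ) ^ 2 / H = 3 * (L : ℝ) ^ 2 * (1 / H) := by ring
        _ ≤ 3 * (L : ℝ) ^ 2 * (2 / x) := mul_le_mul_of_nonneg_left hHinv (by positivity)
        _ = 6 / t ^ 14 := by rw [hx]; field_simp; norm_num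
    have i2 : 6 * (L : ℝ) / H ≤ 12 / (L * t ^ 14) := by
      calc 6 * (L : ℝ) / H = 6 * (L : ℝ) * (1 / H) := by ring
        _ ≤ 6 * (L : ℝ) * (2 / x) := mul_le_mul_of_nonneg_left hHinv (by positivity)
        _ = 12 / (L * t ^ 14) := by rw [hx]; field_simp; norm_num
    have i3 : ((Nat.log 2 (H - 1) : ℝ) + 1) * S₁ ≤ ((2 / ε + 1) * (L : ℝ) ^ ε) * (A * (L : ℝ) ^ (1 + 2 * ε)) :=
      mul_le_mul hlog hS₁le hS₁0 (by positivity)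
    calc ‖∑ n ∈ Finset.Ioc (0 : ℤ) L, e (D 0 n)‖ ^ 2
        ≤ 3 * (L : ℝ) ^ 2 / H + 6 * (L : ℝ) / H * (((Nat.log 2 (H - 1) : ℝ) + 1) * S₁) := by rw [hS₁]; exact hS1
      _ ≤ 6 / t ^ 14 + 12 / (L * t ^ 14) * (((2 / ε + 1) * (L : ℝ) ^ ε) * (A * (L : ℝ) ^ (1 + 2 * ε))) := by
          refine add_le_add i1 (mul_le_mul i2 i3 (by positivity) (by positivity))
      _ = 6 / t ^ 14 + 12 * (2 / ε + 1) * A * ((L : ℝ) ^ ε * (L : ℝ) ^ (1 + 2 * ε)) / (L * t ^ 14) := by ring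
      _ = 6 / t ^ 14 + 12 * (2 / ε + 1) * A * (L : ℝ) ^ (3 * ε) / t ^ 14 := by
          rw [hpow3]; field_simp
      _ ≤ 6 * (L : ℝ) ^ (3 * ε) / t ^ 14 + 12 * (2 / ε + 1) * A * (L : ℝ) ^ (3 * ε) / t ^ 14 := by
          refine add_le_add ?_ le_rfl
          refine div_le_div_of_nonneg_right ?_ (by positivity)
          linarith only [hL3ε]
      _ = C' * (L : ℝ) ^ (3 * ε) / t ^ 14 := by rw [hC']; ring
  -- take square roots
  have hS0 : 0 ≤ ‖∑ n ∈ Finset.Ioc (0 : ℤ) L, e (D 0 n)‖ := norm_nonneg _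
  have hfin : ‖∑ n ∈ Finset.Ioc (0 : ℤ) L, e (D 0 n)‖ ≤ Real.sqrt C' * (L : ℝ) ^ (3 / 2 * ε) / t ^ 7 := by
    calc ‖∑ n ∈ Finset.Ioc (0 : ℤ) L, e (D 0 n)‖ = Real.sqrt (‖∑ n ∈ Finset.Ioc (0 : ℤ) L, e (D 0 n)‖ ^ 2) :=
          (Real.sqrt_sq hS0).symm
      _ ≤ Real.sqrt (C' * (L : ℝ) ^ (3 * ε) / t ^ 14) := Real.sqrt_le_sqrt hS2
      _ = Real.sqrt C' * (L : ℝ) ^ (3 / 2 * ε) / t ^ 7 := by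
          rw [Real.sqrt_div (by positivity), Real.sqrt_mul hC'0.le, Real.sqrt_eq_rpow ((L : ℝ) ^ (3 * ε)),
            ← Real.rpow_mul hL0.le, show (t ^ 14 : ℝ) = (t ^ 7) ^ 2 by ring, Real.sqrt_sq ht7.le]
          congr 2; ring
  have hexp : (L : ℝ) ^ (3 / 2 * ε) ≤ ((L : ℝ) + 1) ^ (2 * ε) := by
    calc (L : ℝ) ^ (3 / 2 * ε) ≤ (L : ℝ) ^ (2 * ε) := Real.rpow_le_rpow_of_exponent_le hL1 (by linarith)
      _ ≤ ((L : ℝ) + 1) ^ (2 * ε) := Real.rpow_le_rpow hL0.le (by linarith) (by linarith)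
  calc ‖∑ n ∈ Finset.Ioc (0 : ℤ) L, e (D 0 n)‖ ≤ Real.sqrt C' * (L : ℝ) ^ (3 / 2 * ε) / t ^ 7 := hfin
    _ ≤ Real.sqrt C' * ((L : ℝ) + 1) ^ (2 * ε) / t ^ 7 := by
        refine div_le_div_of_nonneg_right (mul_le_mul_of_nonneg_left hexp (Real.sqrt_nonneg _)) ht7.le
    _ ≤ (64 + Real.sqrt C') * ((L : ℝ) + 1) ^ (2 * ε) / t ^ 7 := by
        refine div_le_div_of_nonneg_right (mul_le_mul_of_nonneg_right (by linarith) (by positivity)) ht7.le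

/-- Splitting `(0, L]` into blocks of length `≤ M₀`: if every block sum inside `(0, L]` is `≤ B`,
then the whole sum is `≤ (⌊L/M₀⌋ + 1) B`. [folklore] -/
theorem norm_sum_le_blocks (F : ℤ → ℂ) {M₀ : ℕ} (hM₀ : 1 ≤ M₀) {B : ℝ} (hB0 : 0 ≤ B) (L : ℕ)
    (hB : ∀ a b : ℕ, a ≤ b → b ≤ L → b - a ≤ M₀ → ‖∑ n ∈ Finset.Ioc (a : ℤ) b, F n‖ ≤ B) :
    ‖∑ n ∈ Finset.Ioc (0 : ℤ) L, F n‖ ≤ (((L / M₀ : ℕ) : ℝ) + 1) * B := by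
  suffices h : ∀ m : ℕ, m ≤ L → ‖∑ n ∈ Finset.Ioc (0 : ℤ) m, F n‖ ≤ (((m / M₀ : ℕ) : ℝ) + 1) * B from
    h L le_rfl
  intro m
  induction m using Nat.strong_induction_on with
  | _ m ih =>
    intro hmL
    by_cases hm : m ≤ M₀
    · have h1 := hB 0 m (Nat.zero_le _) hmL (by omega)
      rw [Nat.cast_zero] at h1
      calc _ ≤ B := h1
        _ = (0 + 1) * B := by ring
        _ ≤ (((m / M₀ : ℕ) : ℝ) + 1) * B := by
            refine mul_le_mul_of_nonneg_right ?_ hB0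
            have : (0 : ℝ) ≤ ((m / M₀ : ℕ) : ℝ) := by positivity
            linarith
    · rw [not_le] at hm
      have hsplit : Finset.Ioc (0 : ℤ) m = Finset.Ioc (0 : ℤ) ((m - M₀ : ℕ) : ℤ) ∪ Finset.Ioc ((m - M₀ : ℕ) : ℤ) m := by
        rw [Finset.Ioc_union_Ioc_eq_Ioc (by positivity) (by push_cast [Nat.cast_sub hm.le]; linarith)]
      have hdisj : Disjoint (Finset.Ioc (0 : ℤ) ((m - M₀ : ℕ) : ℤ)) (Finset.Ioc ((m - M₀ : ℕ) : ℤ) m) := by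
        rw [Finset.disjoint_left]
        intro y hy hy'
        rw [Finset.mem_Ioc] at hy hy'
        omega
      rw [hsplit, Finset.sum_union hdisj]
      have hIH := ih (m - M₀) (by omega) (by omega)
      have hlast := hB (m - M₀) m (by omega) hmL (by omega)
      have hdiv : ((m / M₀ : ℕ) : ℝ) = (((m - M₀) / M₀ : ℕ) : ℝ) + 1 := by
        have h1 : (m - M₀) / M₀ = m / M₀ - 1 := by
          simpa using Nat.sub_mul_div m M₀ 1
        have h2 : 1 ≤ m / M₀ := (Nat.le_div_iff_mul_le (by omega)).mpr (by simpa using hm.le)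
        have h3 : (m - M₀) / M₀ + 1 = m / M₀ := by omega
        exact_mod_cast h3.symm
      calc _ ≤ ‖∑ n ∈ Finset.Ioc (0 : ℤ) ((m - M₀ : ℕ) : ℤ), F n‖ + ‖∑ n ∈ Finset.Ioc ((m - M₀ : ℕ) : ℤ) m, F n‖ :=
            norm_add_le _ _
        _ ≤ ((((m - M₀) / M₀ : ℕ) : ℝ) + 1) * B + B := add_le_add hIH hlast
        _ = (((m / M₀ : ℕ) : ℝ) + 1) * B := by rw [hdiv]; ring

set_option maxHeartbeats 2000000 in
/-- **Robert–Sargos 2002, Theorem 1, for derivative families** (all sizes of `M`): for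
`t¹³ ≤ f⁗ ≤ C₀ t¹³` on `[0, L]` (`0 < t ≤ 1`, `t = λ^{1/13}`),
`|∑_{0<n≤L} e(f(n))| ≤ C(ε, C₀) (L+1)^{2ε} (L t + t⁻⁷)` — i.e. (1·6),
`S_M ≪_ε M^ε (M λ^{1/13} + λ^{-7/13})`; the case `M ≥ λ^{-8/13}` by "dividing the sum `S_M` into
`O(Mλ^{8/13})` shorter sums" of length `≤ λ^{-8/13}` (Step 0) and `short_bound`.
[cite: RobertSargos2002, Theorem 1, Step 0] -/
theorem theorem1_family (C₀ : ℝ) (hC₀ : 1 ≤ C₀) {ε : ℝ} (hε : 0 < ε) : ∃ C : ℝ, 0 < C ∧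
    ∀ (t : ℝ), 0 < t → t ≤ 1 → ∀ (L : ℕ) (D : ℕ → ℝ → ℝ), DerivFamily D 0 L 4 →
      (∀ x ∈ Set.Icc (0 : ℝ) L, t ^ 13 ≤ D 4 x ∧ D 4 x ≤ C₀ * t ^ 13) →
      ‖∑ n ∈ Finset.Ioc (0 : ℤ) L, e (D 0 n)‖ ≤ C * ((L : ℝ) + 1) ^ (2 * ε) * ((L : ℝ) * t + 1 / t ^ 7) := by
  obtain ⟨Cs, hCs0, hCs⟩ := short_bound C₀ hC₀ hε
  refine ⟨2 * Cs, by positivity, ?_⟩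
  intro t ht ht1 L D hD hb4
  have ht7 : 0 < t ^ 7 := pow_pos ht 7
  have ht8 : 0 < t ^ 8 := pow_pos ht 8
  set y : ℝ := (t ^ 8)⁻¹ with hy
  have hy1 : 1 ≤ y := one_le_inv_iff₀.mpr ⟨ht8, pow_le_one₀ ht.le ht1⟩
  set M₀ : ℕ := ⌊y⌋₊ with hM₀
  have hM₀y : (M₀ : ℝ) ≤ y := Nat.floor_le (by positivity)
  have hM₀y' : y < (M₀ : ℝ) + 1 := Nat.lt_floor_add_one y
  have hM₀1 : 1 ≤ M₀ := Nat.one_le_iff_ne_zero.mpr (by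
    intro h0; rw [h0] at hM₀y'; norm_num at hM₀y'; linarith)
  have hM₀1r : (1 : ℝ) ≤ M₀ := by exact_mod_cast hM₀1
  have hM₀half : y ≤ 2 * M₀ := by linarith
  set B : ℝ := Cs * ((L : ℝ) + 1) ^ (2 * ε) / t ^ 7 with hB
  have hB0 : 0 ≤ B := by rw [hB]; positivity
  -- block bounds by translation
  have hblock : ∀ a b : ℕ, a ≤ b → b ≤ L → b - a ≤ M₀ → ‖∑ n ∈ Finset.Ioc (a : ℤ) b, e (D 0 n)‖ ≤ B := by
    intro a b hab hbL hbaM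
    -- the translated family on `[0, b - a]`
    have hD' : DerivFamily (fun j x => D j (x + a)) 0 ((b - a : ℕ) : ℝ) 4 := by
      intro j hj x hx
      have hba : ((b - a : ℕ) : ℝ) = b - a := by push_cast [Nat.cast_sub hab]; ring
      rw [hba] at hx
      have hbL' : (b : ℝ) ≤ L := by exact_mod_cast hbL
      exact hasDerivAt_shift hD (a : ℝ) hj (by linarith [hx.1]) (by linarith [hx.2])
    have hb4' : ∀ x ∈ Set.Icc (0 : ℝ) ((b - a : ℕ) : ℝ), t ^ 13 ≤ (fun j x => D j (x + a)) 4 x ∧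
        (fun j x => D j (x + a)) 4 x ≤ C₀ * t ^ 13 := by
      intro x hx
      have hba : ((b - a : ℕ) : ℝ) = b - a := by push_cast [Nat.cast_sub hab]; ring
      rw [hba] at hx
      have hbL' : (b : ℝ) ≤ L := by exact_mod_cast hbL
      exact hb4 (x + a) ⟨by linarith [hx.1], by linarith [hx.2]⟩
    have hlen : ((b - a : ℕ) : ℝ) * t ^ 8 ≤ 1 := by
      have h1 : ((b - a : ℕ) : ℝ) ≤ M₀ := by exact_mod_cast hbaM
      calc ((b - a : ℕ) : ℝ) * t ^ 8 ≤ y * t ^ 8 := mul_le_mul_of_nonneg_right (h1.trans hM₀y) ht8.le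
        _ = 1 := by rw [hy]; field_simp
    have key := hCs t ht ht1 (b - a) hlen (fun j x => D j (x + a)) hD' hb4'
    -- the translated sum
    have hshift : ∑ n ∈ Finset.Ioc (a : ℤ) b, e (D 0 n) =
        ∑ n ∈ Finset.Ioc (0 : ℤ) ((b - a : ℕ) : ℤ), e ((fun j x => D j (x + a)) 0 n) := by
      have := sum_Ioc_shift (fun n : ℤ => e (D 0 n)) 0 ((b - a : ℕ) : ℤ) a
      rw [zero_add, show ((b - a : ℕ) : ℤ) + a = b by push_cast [Nat.cast_sub hab]; ring] at this
      rw [← this]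
      refine Finset.sum_congr rfl fun n _ => ?_
      push_cast; ring_nf
    rw [hshift]
    refine key.trans ?_
    rw [hB]
    refine div_le_div_of_nonneg_right (mul_le_mul_of_nonneg_left ?_ hCs0.le) ht7.le
    refine Real.rpow_le_rpow (by positivity) ?_ (by linarith)
    have : ((b - a : ℕ) : ℝ) ≤ L := by exact_mod_cast (Nat.sub_le b a).trans hbL
    linarith
  have hmain := norm_sum_le_blocks (fun n => e (D 0 n)) hM₀1 hB0 L hblock
  -- `⌊L/M₀⌋ ≤ 2 L t⁸`
  have hquot : ((L / M₀ : ℕ) : ℝ) ≤ 2 * L * t ^ 8 := by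
    calc ((L / M₀ : ℕ) : ℝ) ≤ (L : ℝ) / M₀ := Nat.cast_div_le
      _ ≤ (L : ℝ) / (y / 2) := by
          apply div_le_div_of_nonneg_left (by positivity) (by positivity)
          linarith
      _ = 2 * L * t ^ 8 := by rw [hy]; field_simp
  calc ‖∑ n ∈ Finset.Ioc (0 : ℤ) L, e (D 0 n)‖ ≤ (((L / M₀ : ℕ) : ℝ) + 1) * B := hmain
    _ ≤ (2 * L * t ^ 8 + 1) * B := mul_le_mul_of_nonneg_right (by linarith) hB0
    _ = Cs * ((L : ℝ) + 1) ^ (2 * ε) * (2 * (L * t) + 1 / t ^ 7) := by rw [hB]; field_simp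
    _ ≤ 2 * Cs * ((L : ℝ) + 1) ^ (2 * ε) * ((L : ℝ) * t + 1 / t ^ 7) := by
        have h1 : 0 ≤ Cs * ((L : ℝ) + 1) ^ (2 * ε) := by positivity
        have h2 : 0 ≤ 1 / t ^ 7 := by positivity
        nlinarith only [h1, h2]

end Thm1

end RobertSargos
end Literature.NumberTheory.LFunctions

end
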